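import Summits.ValiantsHypothesis.ValiantsHypothesis.Theses.ValuativeGCT
import Literature.NumberTheory.DiophantineGeometry.SchurWeylPlethysmKroneckerBoundProofs
import Literature.NumberTheory.DiophantineGeometry.SchurWeylPlethysmOrbitWeightsProofs
import Literature.NumberTheory.DiophantineGeometry.GLHighestWeightFormRepProofs
import Literature.NumberTheory.DiophantineGeometry.KroneckerOneRow
import Literature.Computability.AlgebraicComplexity.OrbitCoordinateRingProofs
import Literature.RingTheory.MvPolynomial.VanishingOnSubspace

set_option linter.dupNamespace false

/-!
# Disproof of `ValuativeBound` (crux `stmt-ValiantsHypothesis-12625`, route ValuativeGCT) — findings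

Standing adversary file (cdisprove), generation 2 / cycle 3, v10 (cycle close), 2026-08-16.  Lean only; prose lives in
docstrings.  `lean check` rc 0, no `sorry`, axioms `propext / Classical.choice / Quot.sound`.

**VERDICT: the crux RESISTS — it is TRUE (PROVED, pending a prover's landing).**  VERIFIED IN THIS
SESSION: the tree file `Cruxes/ValuativeBound/TRIAGE-r1-3-ValuativeBoundProof.lean` (triager r1-3-g2,
527 lines) compiles here (`lean check` rc 0, 0 sorry) and
`TriageR1K3.valuativeBound_holds : Summit.….Theses.ValuativeGCT.ValuativeBound` has axioms
`[propext, Classical.choice, Quot.sound]` (type-checked against the route decl by an appended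
`example`; a deliberately mistyped control fails).  An earlier complete candidate
(`valuativeBound_holds`, planner-cruxidea-2, evidence `ValuativeBoundProof.lean`) takes the same line.
Both go through the tree's injective `hwToPoly`
(`SchurWeylPlethysmKroneckerBoundProofs` §1): lift a hw class by complete reducibility, push it
through the generic orbit map `A ↦ F(det_m(xA))`, check T's four clauses (degree by
`isHomogeneous_orbitCoordToPoly`, Stab / Borel by `eval_orbitCoordToPoly_mul_right/left`,
valuation by CoeffVanishingOrder = stmt-12628 + generators-to-powers), `finrank` monotonicity.
Three independent triagers re-derived the glue (TRIAGE-r1-{1,2,3}.md).  CYCLE 3: the registered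
line file `Cruxes/ValuativeBound/Lines/det-transversal-order-transport.lean` (planner-cruxplan, 749
lines, skeleton f228caf5…, stubs `stub_kernelColumnDivisibility` + `stub_linearPower_of_lineRestriction`
both PROVED inside it) is a THIRD complete proof, by a different line (order of vanishing of `det_m`
along `U` decided on `W`, transported coefficientwise): re-verified here rc 0 / 0 sorry,
`DetTransversalOrderTransport.ValuativeBound_of` axioms `[propext, Classical.choice, Quot.sound]`,
type = route decl (appended `example`), and it closes `CoeffVanishingOrder` (stmt-12628) as well
(`coeffVanishingOrder_of`, audit closed = true).  The item now only awaits a PROVER landing one of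
the three files.  Nothing below contradicts them;
everything below says WHICH hypotheses / conventions that proof must use, and which natural
strengthenings are false.

## Index (theorem names in namespace `…Cruxes.ValuativeBound.Disproof`)

§1 ENGINE (general `m ≥ 1`, new in cycle 2).
* `one_le_orbitMultiplicity_det_lastWeight m δ : 1 ≤ K_m((0,…,0,-mδ))` and its crux-weight form
  `one_le_orbitMultiplicity_det_indiscrete m δ : 1 ≤ K_m((dualOfPartition (m*m) (mδ)).toMatIdx)`.
  Witness: the class of `X_{x_last^m}^δ` — a `B`-eigenvector (`coordSubst_X_dLast_pow`: only the
  last variable feeds the last variable under an upper triangular substitution,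
  `coeff_single_iLast_linSubst_monomial`) that is NOT in `I(GL·det_m)` because it takes the value 1
  at the End-orbit point `det_m(x ↦ [a=b]x_last) = x_last^m` (`linSubst_diagToLast_detFormLex`,
  kernel = generic orbit map).  So the LHS of the crux is `≥ 1` on every one-row shape: any variant
  whose `T` collapses on a one-row shape is refuted outright.
* `toMatIdx_dualOfPartition_indiscrete`: the crux's weight of `λ = (mδ)` is `(0,…,0,-mδ)` — the
  dual convention puts `-λ₁` on the lex-LAST index `(m-1,m-1)` (`val_matIdxEquiv_symm_iLast`).

§5 TIGHT ON EVERY ONE-ROW SHAPE, EVERY `m ≥ 1` (new in cycle 3, section `TightOneRow`; landed as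
`Theorems/ValuativeGCTValuativeBoundNegativeTightOneRow.lean`, p72088 ACCEPTED).
* `truncation_lastWeight_le_span L t δ : T(L, t, mδ, (0,…,0,-mδ)) ≤ ℂ ∙ det_m(A_last)^δ` for EVERY
  locus and threshold; `finrank_truncation_lastWeight_le_one`;
  `finrank_truncation_indiscrete_le_orbitMultiplicity U r δ : dim T_U((mδ)) ≤ K_m((mδ)*)` — the
  REVERSE inequality on one-row shapes, no rank hypothesis; `valuativeBound_tight_oneRow :
  ValuativeBound → K_m((mδ)*) = dim T_U((mδ)) = 1`; `not_orbitMultiplicity_lt_finrank_truncation_indiscrete`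
  (strict variant false at every `m`, every `U, r, δ`).
* Mechanism WITHOUT the first fundamental theorem: Lemma R ⇒ `G = g(A_last)`
  (`exists_rename_lastRow_eq`); Stab clause at `rowOp P : x ↦ P·x`, `det P = 1`
  (`linSubst_rowOp_detFormLex : det_m ∘ rowOp P = det P · det_m`) ⇒ `g` is left-`SL_m`-invariant
  (`linSubst_eq_of_rename_mem_stabInvariants`); `A = P·diag(1,…,1,det A)` with `det P = 1`
  (`exists_eq_mul_cornerDiag`) ⇒ `g·det_m = g(diag(1,…,1,det_m))·det_m` pointwise ⇒ as polynomials
  ⇒ `g = h(det_m)`, `h` univariate (`aeval_cornerSubst_eq`) ⇒ degree-`mδ` component: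
  `g = c·det_m^δ` (`exists_eq_smul_detFormLex_pow`).  Consequence for the programme: flips need
  `≥ 2` rows at every `m` (CutBites / ValuativeFlip seats), not just at `m = 1`.

§6 THE CUT IS BLIND ON COMPRESSION SPACES, EVERY `m`, `δ`, WEIGHT (new in cycle 3, sections
`StabTorus` + `CompressionBlind`; landed as `Theorems/…NegativeStabTorus.lean` (p72625) +
`…NegativeCompressionBlind.lean` (p72860), both ACCEPTED).
* `linSubst_torusDiag_detFormLex : det_m ∘ (x_{ab} ↦ s_a t_b x_{ab}) = (∏s)(∏t)·det_m` — the torus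
  `S(T_m × T_m) ⊂ Stab(det_m)`; BALANCE `rowSlots_eq` / `colSlots_eq`: every monomial of a degree-`mδ`
  Stab-invariant `G` has EXACTLY `δ` slots in each matrix row `a` and each matrix column `b`.
* `blockSpace R C = {u : u_{ab} = 0, a ∈ R, b ∈ C}` (coordinate compression space; every member has
  rank `≤ 2m - |R| - |C|`, `rank_le_of_mem_blockSpace`); counting (`le_blockSlots`): `≥ δ(|R|+|C|-m)`
  = `δ(m - r)` slots of every monomial lie in the block, and block variables vanish on `L_U`, so
  `mem_vanishingIdeal_pow_blockSpace : Hom_(mδ) ⊓ Stab ≤ I(L_U)^(δ(m-r))` — the valuative clause is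
  IMPLIED by the degree + Stab clauses; `truncation_blockSpace_eq_symTruncation :
  T_U(λ) = symTruncation := Hom ⊓ Stab ⊓ Borel` and `valuativeBound_at_blockSpace_iff`: instantiated
  at ANY compression space (with its natural `r`) the crux IS the symmetric Kronecker-type bound —
  no information beyond BLMW Prop 5.2.1.  (Every compression space is `P·blockSpace·Q` and
  `symTruncation` is Stab-invariant, so coordinate position is no loss — remark.)  CONSEQUENCE FOR THE
  PROGRAMME: the cut can only bite through NON-compression singular spaces (`Λ₃ ⊂ M₃` is the first,
  Eisenbud–Harris / Atkinson; none exist for `m ≤ 2`, which with §5 re-explains "m = 2 is blind");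
  ValuativeFlip / CutBites seats must take `U` non-compression, and by balance the threshold
  `δ(m-r)` is met with EQUALITY by every monomial at a compression space (so `threshold + 1` empties
  `T` there — cf. `valuativeBound_false_succ_threshold`).
* KIT TOYS (cycle 3; scripts `m3job/`, `m3v2/` = jobs j007780 (m = 2), j010569 (m = 3, v2); tables in the
  item evidence `KitToyM3d2.md`, `KitToyM3d3.md`, exact certificate `G222.txt`).  Model of `T_0(λ)` /
  `T_Λ₃(λ,t)`: torus weight `λ*`, row-raising operators (unipotent `B` via `g⁻¹`), Stab-torus balance
  (§6), Chevalley generators of `sl₃ ⊕ sl₃` on the matrix position, transpose `τ`; mod-p ranks, two primes.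
  - m = 2, every `λ ⊢ 2δ`, `δ ≤ 6` (88 shapes): `dim T_0(λ) = [λ even] = K_2(λ)` — the SYMMETRIC truncation
    is already exact at m = 2 (FFT for O₄), so no cut can bite there (and §6: every singular space of M₂
    is a compression space anyway).
  - m = 3, δ = 2, all 11 `λ ⊢ 6`: `K_3(λ) = dim T_Λ₃(λ, t=2)` for EVERY λ — the crux is an EQUALITY at
    `(m,δ,U) = (3,2,Λ₃)` (cross-validating every convention numerically), while `T_0` has slack exactly
    at `λ = (2,2,2)`: `dim T_0((2,2,2)) = 1 > 0 = K` — spanned by `G₂₂₂`, the degree-6 fundamental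
    invariant of the 3×3×3 tensor (EXACT over ℚ: 1152 terms, integer coefficients `|c| ≤ 10`, all
    clauses verified exactly), which is not `Φ` of `Sym²(Sym³)` (`h₂[h₃] = s₆ + s₄₂`); and THE CUT BITES:
    `G₂₂₂(û₁,û₂,û₃) = 12·det(u₁u₂u₃)²` on skew triples, so `ord_{L_Λ₃} G₂₂₂ = 0 < 2` and
    `dim T_Λ₃((2,2,2)) = 0 = K`.  (`(3,1,1,1)`: `g(λ,(2³),(2³)) = 1` but `T_0 = 0` — `τ` acts by `−1`.)
  - m = 3, δ = 3 (17 of 30 shapes so far, all with ≤ 4 parts; j010569 completes):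
    `dim T_Λ₃(λ, t=3) = [λ ∈ supp h₃[h₃]] = [λ ∈ {(9),(7,2),(6,3),(5,2,2),(4,4,1)}] ≥ K_3(λ)`; `T_0` has
    slack `+1` at `(5,2,2)`, `(4,2,2,1)` (and by Pieri `s₂₂₂·s₃ = s₅₂₂ + s₄₂₂₁ + s₃₂₂₂` presumably
    `(3,2,2,2)`): exactly the `G₂₂₂ · (cubic invariants)` ideal, no new generator (`T_0((3,3,3)) = 0`); at
    `(5,2,2)` the cut removes precisely the slack direction (`ord 1 < 3`).
  UPSHOT for the crux: in every computed cell the valuative truncation at the right `U` is as small as the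
  plethysm allows — the inequality `K ≤ dim T_U` has no visible slack to attack at m ≤ 3, δ ≤ 3, and the
  only slack of the SYMMETRIC bound (the `G₂₂₂`-ideal) is killed by `Λ₃` — positive evidence for the
  route (CutBites / ValuativeFlip), not an opening for a disproof.

§7 ORBIT INVARIANCE / MONOTONICITY (new in cycle 3, section `OrbitInvariance`; landed as
`Theorems/…NegativeOrbitInvariance.lean`, p72747 ACCEPTED).
* `truncation_rowLocus_le_comap : det_m ∘ M = det_m → T_U ≤ T_{U·M⁻¹}` (`U·M⁻¹ = comap (· ᵥ* M) U`,
  `M` need not be invertible): `T_U` sees `U` only through its `Stab(det_m)`-saturation — only the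
  EQUIVALENCE CLASS of the singular space matters (`Λ₃ ~ P·Λ₃·Q`), and enlarging `U` to a
  `Stab`-saturated space can only shrink `T`.
* `truncation_antitone_locus`, `truncation_rowLocus_antitone` (`U ≤ U' ⇒ T_{U'} ≤ T_U`: maximal
  singular spaces of each rank cut most), `truncation_antitone_threshold`.
  With §6: the ONLY candidates for a biting cut are the maximal NON-compression singular spaces up
  to equivalence — for `m = 3` that is `Λ₃` alone (rank ≤ 2 spaces of `M₃` are compression or
  `~Λ₃`, Atkinson / Eisenbud–Harris), which is exactly the route's cheapest falsifier; j007827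
  computes it at `δ = 2`.

§0 ANCHOR. `truncation m L t n χ := Hom_n ⊓ I(L)^t ⊓ stabInvariants ⊓ borelSemiInvariants χ`
(the crux's `T`, verbatim, with locus / threshold / degree / weight exposed) and
`valuativeBound_iff : ValuativeBound ↔ ∀ …, K_m(λ*) ≤ finrank (truncation m (rowLocus m U) (δ(m-r)) (mδ) λ*)`
**by `Iff.rfl`**.  Every variant below changes exactly one argument of this normal form.

§2 LOAD-BEARING HYPOTHESES ("any proof must use H"): each dropped ⇒ FALSE, sorry-free.
* rank hypothesis `∀ u ∈ U, rank u ≤ r`: `valuativeBound_false_without_rank`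
  (`withoutRank_fails_at m` for EVERY `m ≥ 1`: `U = ⊤, r = 0, δ = 1, λ = (m)`; `I(everything)^m = 0`).
* guard `λ.parts.card ≤ m*m`: `valuativeBound_false_without_card` (`m = 1, U = 0, r = 0, δ = 2,
  λ = (1,1)`: truncated weight `(-1)` has size `-1 ≠ -2 = -deg`; DEGREE–SIZE MISMATCH lemma
  `eq_zero_of_degree_ne_size` kills `T`, while `K_1((-1)) = 1`).
* `NeZero m`: NOT load-bearing for truth (at `m = 0` everything is `0 ≤ …`), but needed to state
  `K_m ≥ 1`; gen-1 recorded the same.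

§3 TIGHTNESS / STRENGTHENINGS refuted.
* **attained at `m = 1` (section `TightAtOne`)**: `X_pow_mem_truncation_one` (the monomial `A^δ` IS
  in the crux's `T_0((δ)*)` — a NON-JUNK INHABITANT of `T`, all four clauses checked),
  `truncation_one_le_span` (`T ⊆ ℂ·A^n` in one variable), `finrank_truncation_one : dim T_0((δ)*) = 1`,
  `finrank_truncation_one_le_orbitMultiplicity : dim T ≤ K_1`; hence the STRICT variant `K < dim T`
  is FALSE: `valuativeBound_false_strict`.  EVERY `m`: the bound is attained on EVERY one-row shape
  `λ = (mδ)`, every `(U, r)` — cycle 2 had this on paper via FFT; cycle 3 PROVES it in Lean without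
  FFT (§5): `dim T_U((mδ)) ≤ 1 ≤ K_m((mδ)*)`, so the cut never bites on one-row shapes.
* threshold `δ(m-r) ↦ δ(m-r)+1`: `valuativeBound_false_succ_threshold` (`succThreshold_fails_at m`,
  every `m ≥ 1`: `U = ⊤, r = m, δ = 1, λ = (m)`).  Honest version (order of vanishing along `L_0 = {0}`
  is EXACTLY `δ(m-r)`): `m = 1`, `T_0 = ℂ·A^δ`, `A^δ ∉ (A)^(δ+1)` — gen-1
  `not_valuativeBoundSharperThreshold`; and at the estimate level the exponent `m-r` of
  CoeffVanishingOrder is attained at `m = 2` (gen-1 `coeffVanishingOrder_false_with_exponent_succ`,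
  line `E₁₁ + tE₀₀`).  Folklore source: mult of `{det = 0}` at a rank-`r` point is `m-r`
  (ACGH I, Ch. II §2).
* NON-DUAL weight (`ofPartition` for `dualOfPartition`): NOT a refutation but a VACUITY — weights
  occurring in coordinate rings are `≤ 0` (tree `nonpos_and_exists_size_eq_of_hasHighestWeight_orbitCoordRep`),
  so `K_m(ofPartition λ) = 0` for `λ ≠ 0` and the variant is trivially true.  (Planner note: the
  dual convention is the meaningful one; it is the tree's, `orbitMultiplicity_det_le_kroneckerCoeff`.)
* FREE STRENGTHENING that holds (gen-1 remark, re-confirmed): the Φ-injection lands in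
  `⋂_{(U,r)} T_U` over ALL rank-bounded spaces simultaneously (incl. `P·U·Q` translates and
  transposes); ValuativeFlip may intersect truncations.

§4 CONVENTIONS — each of the three "slips" the planner feared is now a sorry-free FALSE variant,
so the crux's choices are not only consistent (gen-1 / route review audit) but FORCED:
* ROWS in `L_U` (columns variant FALSE): `valuativeBound_false_with_columns` (`m = 2`, `U = ℂ·E₁₁`,
  `r = 1`, `δ = 1`, `λ = (2)`): by LEMMA R (`apply_eq_zero_of_mem_borelSemiInvariants_lastWeight`:
  a semi-invariant of weight `(0,…,0,-n)` lives on the LAST ROW — torus `diag(1,…,1 | 2⁻¹)`) a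
  last-row form vanishing on `{columns ∈ ℂ·e_last} = {only the last row free}` is `0`; `K ≥ 1`.
* RIGHT action of Stab (left variant FALSE): `valuativeBound_false_left_stab` (`m = 2`, `U = ⊤`,
  `r = 2`, `δ = 1`, `λ = (2)`, no vanishing condition): Lemma R + invariance under the row swap
  `(0,0) ↔ (1,1)` (`linSubst_swapMatrix_detFormLex : swap ∈ Stab(det_2)`) empties the support.
* `g⁻¹` in the Borel clause (`g` variant FALSE at EVERY `m ≥ 1`): `valuativeBound_false_borel_no_inv`
  / `borelNoInv_fails_at m` (`U = ⊤, r = m, δ = 1, λ = (m)`): the scalar `2·1 ∈ B` would act by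
  `2^m` (homogeneity) and by `2^{-m}` (clause) at once.
Gen-1's estimate-level column lemma `coeffVanishingOrder_false_with_columns` (m = 2) is the same
phenomenon one level down.

## Targets (cycle 3; payload.targets = [], payload.stuck_stubs = [])
Registered skeleton f228caf5… (line det-transversal-order-transport) has ONE active stub,
`stub_linearPower_of_lineRestriction : ∀ m t U p, (∀ u ∈ U, ∀ y, X^t ∣ p(u + X·y)) → p ∈ (span{ℓ ∈ Hom_1 |
ℓ|_U = 0})^t` — "order of vanishing along a linear subspace is read off one-parameter restrictions".
It is TRUE (adapted coordinates `U = {x_T = 0}`: the lowest `x_T`-degree part of `p` shows up as the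
lowest power of `X` for generic `(u, y)`, `ℂ` infinite) and it is PROVED, sorry-free, inside the line
file (`linearPower_of_basis`, `mem_pow_span_X_of_dvd_scaled`) — nothing to kill.  Its hypotheses are
load-bearing in the obvious ways (information for re-users, checked on paper): directions `y` over a
BASIS only is false (`p = x₁x₂`, `U = 0`, `t = 3`: `p(X e_i) = 0` yet `p ∉ 𝔪³`); base points `u = 0`
only is false for `U ≠ 0` (`m = 1`, `U = ⊤`, `p = x`, `t = 1`: `X ∣ p(Xy)` yet `p ∉ (0)`).  The other
two lines (hwtopoly-density-transport, hwtopoly-range-in-truncation) have all stubs certified by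
their planners (`HwtopolyDensityTransportStubProofs.lean`) modulo `CoeffVanishingOrder`, which the
third proof closes.

## Why it resists (for ideators / the lead)
The inequality is a chain of four containments each of which is an IDENTITY of the generic orbit
map, plus one valuative estimate; there is no slack to attack except the estimate's exponent, and
that exponent is exactly the multiplicity `m - r` of `det_m` along rank-`r` matrices, which is
classical.  Small cases: `m = 1`: both sides `1` (T = ℂ·A^δ).  `m = 2`: `Δ(det_2) = Sym²(ℂ⁴)^*`
(all quadratic forms — Bürgisser–Ikenmeyer, arXiv:1511.02927, remark after Cor. 3.29, p.14 of the
held text: "the orbit closures of det_2 and per_2 equal Sym²ℂ⁴ and hence are normal"; non-normal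
for `n > 2`, Cor. 3.29(2)), `I(GL·det_2) = 0`, and `ℂ[End ℂ⁴]^{O(det_2)} = ℂ[Gram entries]` (FFT for
`O_4` on 4 vectors, no relations) so `K_2(λ) = dim T_0(λ)` for ALL `λ` — the bound is TIGHT at
`U = 0`, and every singular `U ⊂ Mat_2` is a compression space whose Gram entries vanish to order
exactly 1 along `L_U`, so `T_U = T_0`: the cut never bites at `m = 2` (consistent with "no Edmonds
gap below m = 3").  `m = 3, δ = 2, U = Λ₃` (route's cheapest falsifier): `T_0` types
`(6),(4,2),(2,2,2)`; `K_3 = (1,1,0)`; the `(6)` and `(4,2)` vectors are `det(A_last)²` and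
`D(u,u,u)D(u,v,v) - D(u,u,v)²` (mixed determinants), each quadratic in coefficients of
`det_3(xA)` hence in `I(L_Λ)²` ⇒ `dim T_Λ ≥ (1,1,·)` ⇒ no violation; `(2,2,2)` is CutBites' business.

## Literature (cycle 2; gen-1 was search-degraded)
`lit search` (searchd) rc 75 all cycle; `lit galaxy search "orbit closure of the determinant" --star all`:
5 rows (Landsberg 2017 book; LMR 2013 degenerate duals; Bläser–Dörfler–Ikenmeyer CCC 2021 hw-vector
evaluation; ELSW shifted partials; Yeliussizov) — none states or contradicts a valuative upper bound
on `K_m(λ)`; arXiv:1511.02927 read (pp. 9–14): non-normality of `Δ(det_n)`, `n ≥ 3`, via the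
fundamental invariant / stabilizer period — consistent with (indeed the motivation of) the
truncation, no counterexample family.  `ledger negatives --problem ValiantsHypothesis`: 4 refuted
items (UlrichPadded, Elusive candidate, Grenet ×2) — none bears on a det-side upper bound.

## Landing (negative side → `Theorems/`, `--supports stmt-12625`, namespace
`Summit.ValiantsHypothesis.Theorems.ValuativeBoundNegative`; importable by ideators / planners / the lead)
* p70648 ACCEPTED (a1d106bc6bfb) `Theorems/ValuativeGCTValuativeBoundNegativeEngine.lean` — §1 engine.
* p70859 ACCEPTED (524905912dbb) `…NegativeLoadBearing.lean` — §0 anchors + §2 (rank, card guard,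
  threshold+1; degree–size mismatch).
* p71250 ACCEPTED (676305c0facc) `…NegativeColumns.lean` — Lemma R + columns variant.
* p71251 ACCEPTED (5d68b998c4b3) `…NegativeTightAtOne.lean` — §3' tightness at `m = 1`, strict variant.
* p71486 ACCEPTED (0fb5ccf29b15) `…NegativeSideAndInverse.lean` — left Stab, `g`-for-`g⁻¹`.
* p72088 ACCEPTED (b98660e35e11, cycle 3) `…NegativeTightOneRow.lean` — §5 one-row tightness at every `m`
  (imports `…NegativeColumns` + `Literature.RingTheory.MvPolynomial.VanishingOnSubspace`).
* p72625 ACCEPTED (c832042f791b, cycle 3) `…NegativeStabTorus.lean` — §6 torus + balance.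
* p72860 ACCEPTED (04d0b8abb3c1, cycle 3) `…NegativeCompressionBlind.lean` — §6 blockSpace, blindness, rank bound.
* p72747 ACCEPTED (6184e38cc8b9, cycle 3) `…NegativeOrbitInvariance.lean` — §7.
All nine negative-side files are in the tree; ideators / planners / the lead may `import` them.
In those files the refuted variants are stated INLINE (no `def … : Prop`); this workfile keeps the
named `ValuativeBound…` variants for readability.

## Provenance
gen-1 file (945 lines, 63 thms; evidence `…T225042Z-Disproof.lean`) is NOT readable from gen-2's
jail (run/gate/evidence unmounted; no crux workfile existed).  This file RE-DERIVES its Part I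
(load-bearing at m = 1 → now at every m) independently and adds the general-m engine; gen-1's
Part II (m = 2 estimate-level lemmas) and Part III (Φ / stabSubst / borelSubst identities:
`stabSubst_Φ`, `Φ_coordSubst`, `borelSubst_Φ_of_semiInvariant`, `aeval_Φ`,
`mem_orbitVanishingIdeal_of_Φ_eq_zero`, `Φ_mem_pow_of_coeff_mem_pow`) are cited, not repeated —
the tree now carries the same identities as `eval_orbitCoordToPoly_mul_left/right`,
`isHomogeneous_orbitCoordToPoly`, `orbitVanishingIdeal_eq_ker_genericOrbitMap`.
-/





noncomputable section

open MvPolynomial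

namespace Summit.ValiantsHypothesis.ValiantsHypothesis.Cruxes.ValuativeBound.Disproof

open Literature.NumberTheory.DiophantineGeometry Literature.Computability.AlgebraicComplexity

section Engine

variable (m : ℕ) [NeZero m]

/-- The lex-greatest matrix index `(m-1, m-1)` of `MatIdx m = Fin m ×ₗ Fin m`. -/
def iLast : MatIdx m :=
  toLex (⟨m - 1, Nat.sub_one_lt (NeZero.ne m)⟩, ⟨m - 1, Nat.sub_one_lt (NeZero.ne m)⟩)

/-- Every matrix index is `≤ iLast m`. -/
theorem le_iLast (i : MatIdx m) : i ≤ iLast m := by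
  rw [← toLex_ofLex i, iLast, Prod.Lex.toLex_le_toLex]
  have h1 := (ofLex i).1.isLt
  have h2 := (ofLex i).2.isLt
  rcases lt_or_ge ((ofLex i).1 : ℕ) (m - 1) with h | h
  · exact Or.inl (Fin.lt_def.mpr (by simpa using h))
  · right
    exact ⟨Fin.ext (by simp; omega), Fin.le_def.mpr (by simp; omega)⟩

/-- No index is strictly above `iLast m`. -/
theorem not_iLast_lt (i : MatIdx m) : ¬ iLast m < i :=
  not_lt.mpr (le_iLast m i)

/-- The degree-`m` monomial index of `x_{iLast}^m`. -/
def dLast : DegIdx (MatIdx m) m :=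
  ⟨Finsupp.single (iLast m) m, by rw [mem_degMonomials_iff, Finsupp.degree_single]⟩

/-- Unfolding lemma for `dLast`. -/
@[simp] theorem dLast_val : (dLast m : MatIdx m →₀ ℕ) = Finsupp.single (iLast m) m := rfl

variable {m}

/-- For an upper triangular matrix `B`, the coefficient of `x_{iLast}^m` in `B · x^e` is
`B_{iLast,iLast}^m` if `e = x_{iLast}^m` and `0` otherwise (only the last variable feeds the last
variable). -/
theorem coeff_single_iLast_linSubst_monomial {k : Type*} [Field k] {B : Matrix (MatIdx m) (MatIdx m) k}
    (hB : B.BlockTriangular id) (e : MatIdx m →₀ ℕ) :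
    coeff (Finsupp.single (iLast m) m) (linSubst (MatIdx m) k B (monomial e 1)) =
      if e = Finsupp.single (iLast m) m then B (iLast m) (iLast m) ^ m else 0 := by
  classical
  -- β = indicator of the last index; diagonal β ∘ B = diagonal β'
  set β : MatIdx m → k := fun i => if i = iLast m then 1 else 0 with hβ
  set β' : MatIdx m → k := fun i => if i = iLast m then B (iLast m) (iLast m) else 0 with hβ'
  have hmul : Matrix.diagonal β * B = Matrix.diagonal β' := by
    ext j i
    rw [Matrix.diagonal_mul, Matrix.diagonal_apply]
    by_cases hj : j = iLast m
    · subst hj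
      by_cases hi : iLast m = i
      · subst hi; simp [hβ, hβ']
      · rw [if_neg hi]
        have hlt : i < iLast m := lt_of_le_of_ne (le_iLast m i) (Ne.symm hi)
        simp only [hβ, if_true, one_mul]
        exact hB hlt
    · have : β j = 0 := by simp [hβ, hj]
      rw [this, zero_mul]
      by_cases hji : j = i
      · subst hji; simp [hβ', hj]
      · rw [if_neg hji]
  have key : ∀ q : MvPolynomial (MatIdx m) k, coeff (Finsupp.single (iLast m) m) q =
      coeff (Finsupp.single (iLast m) m) (linSubst (MatIdx m) k (Matrix.diagonal β) q) := by
    intro q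
    rw [coeff_linSubst_diagonal]
    have : (∏ i, β i ^ (Finsupp.single (iLast m) m) i) = 1 := by
      refine Finset.prod_eq_one fun i _ => ?_
      by_cases hi : i = iLast m
      · subst hi; simp [hβ]
      · rw [Finsupp.single_apply, if_neg (Ne.symm hi), pow_zero]
    rw [this, one_mul]
  rw [key, ← AlgHom.comp_apply, ← linSubst_mul, hmul, coeff_linSubst_diagonal, coeff_monomial]
  have hprod : (∏ i, β' i ^ (Finsupp.single (iLast m) m) i) = B (iLast m) (iLast m) ^ m := by
    rw [Finset.prod_eq_single (iLast m)]
    · simp [hβ']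
    · intro i _ hi
      rw [Finsupp.single_apply, if_neg (Ne.symm hi), pow_zero]
    · intro h; exact absurd (Finset.mem_univ _) h
  rw [hprod]
  split_ifs with h <;> simp

/-- **The Borel acts on the coordinate `X_{x_last^m}` by the character `b ↦ b_{last,last}^{-m}`.** -/
theorem coordSubst_X_dLast {k : Type*} [Field k] {g : GL (MatIdx m) k} (hg : IsUpperTriangular g) :
    coordSubst m g (X (dLast m) : MvPolynomial (DegIdx (MatIdx m) m) k) =
      (((g : Matrix (MatIdx m) (MatIdx m) k) (iLast m) (iLast m))⁻¹ ^ m) • X (dLast m) := by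
  classical
  have hg' : IsUpperTriangular g⁻¹ := (borelSubgroup (MatIdx m) k).inv_mem hg
  rw [coordSubst_X, Finset.sum_eq_single (dLast m)]
  · rw [linSubstRep_apply, dLast_val, coeff_single_iLast_linSubst_monomial hg', if_pos rfl,
      inv_apply_diag_of_isUpperTriangular' hg]
  · intro e _ hne
    rw [linSubstRep_apply, dLast_val, coeff_single_iLast_linSubst_monomial hg', if_neg, zero_smul]
    intro h
    exact hne (Subtype.ext h)
  · intro h; exact absurd (Finset.mem_univ _) h

variable (m)

/-- The weight `(0, …, 0, -n)` on `MatIdx m` (entry `-n` at the lex-last index). -/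
def lastWeight (n : ℕ) : Weight (MatIdx m) :=
  fun i => if i = iLast m then -(n : ℤ) else 0

/-- The character of `lastWeight m n` is `g ↦ (g_{last,last})^{-n}`. -/
theorem weightChar_lastWeight {k : Type*} [Field k] (n : ℕ) (g : GL (MatIdx m) k) :
    weightChar (lastWeight m n) g = (((g : Matrix (MatIdx m) (MatIdx m) k) (iLast m) (iLast m))⁻¹) ^ n := by
  classical
  rw [weightChar, Finset.prod_eq_single (iLast m)]
  · simp [lastWeight, zpow_neg, zpow_natCast, inv_pow]
  · intro i _ hi
    simp [lastWeight, hi]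
  · intro h; exact absurd (Finset.mem_univ _) h

/-- **`X_{x_last^m}^δ` is a `B`-semi-invariant of weight `(0,…,0,-mδ)` in `k[Sym^m]`.** -/
theorem coordSubst_X_dLast_pow {k : Type*} [Field k] {g : GL (MatIdx m) k} (hg : IsUpperTriangular g)
    (δ : ℕ) :
    coordSubst m g ((X (dLast m) : MvPolynomial (DegIdx (MatIdx m) m) k) ^ δ) =
      weightChar (lastWeight m (m * δ)) g • (X (dLast m)) ^ δ := by
  rw [map_pow, coordSubst_X_dLast hg, smul_pow, weightChar_lastWeight, ← pow_mul]

/-- The class of `X_{x_last^m}^δ` in `k[Δ(f)]` is a highest-weight vector of weight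
`(0,…,0,-mδ)`, for every form `f`. -/
theorem mk_X_dLast_pow_mem_highestWeightSpace {k : Type*} [Field k] (f : MvPolynomial (MatIdx m) k)
    (δ : ℕ) :
    Ideal.Quotient.mk (orbitVanishingIdeal f m) ((X (dLast m) : MvPolynomial (DegIdx (MatIdx m) m) k) ^ δ) ∈
      highestWeightSpace (orbitCoordRep f m) (lastWeight m (m * δ)) := by
  intro g hg
  rw [orbitCoordRep_apply, orbitCoordSubst_mk, coordSubst_X_dLast_pow m hg]
  exact map_smul (Ideal.Quotient.mkₐ k (orbitVanishingIdeal f m)) _ _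

/-- The singular substitution `x_{ab} ↦ [a = b] · x_{last}` (all diagonal variables to the last
variable, off-diagonal variables to `0`), as a matrix for `linSubst`. -/
def diagToLast (k : Type*) [Field k] : Matrix (MatIdx m) (MatIdx m) k :=
  fun j i => if j = iLast m ∧ (ofLex i).1 = (ofLex i).2 then 1 else 0

/-- `diagToLast` sends the variable `x_{ab}` to `[a = b]·x_last`. -/
theorem linSubst_diagToLast_X {k : Type*} [Field k] (a b : Fin m) :
    linSubst (MatIdx m) k (diagToLast m k) (X (toLex (a, b))) = if a = b then X (iLast m) else 0 := by
  classical
  rw [linSubst_X, Finset.sum_eq_single (iLast m)]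
  · simp only [diagToLast, ofLex_toLex, true_and]
    split_ifs <;> simp
  · intro j _ hj
    simp [diagToLast, hj]
  · intro h; exact absurd (Finset.mem_univ _) h

/-- **`det_m` under `x_{ab} ↦ [a=b] x_last` is `x_last^m`.** -/
theorem linSubst_diagToLast_detFormLex {k : Type*} [Field k] :
    linSubst (MatIdx m) k (diagToLast m k) (detFormLex k m) = X (iLast m) ^ m := by
  classical
  rw [detFormLex, detPoly, AlgHom.map_det, AlgHom.map_det]
  have : ((linSubst (MatIdx m) k (diagToLast m k)).mapMatrix
      ((rename toLex : MvPolynomial (Fin m × Fin m) k →ₐ[k] _).mapMatrix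
        (Matrix.mvPolynomialX (Fin m) (Fin m) k))) = Matrix.diagonal fun _ => X (iLast m) := by
    ext a b
    simp only [AlgHom.mapMatrix_apply, Matrix.map_apply, Matrix.mvPolynomialX_apply, rename_X,
      linSubst_diagToLast_X, Matrix.diagonal_apply]
  rw [this, Matrix.det_diagonal, Finset.prod_const, Finset.card_univ, Fintype.card_fin]

/-- **`X_{x_last^m}^δ ∉ I(GL · det_m)`**: it takes the value `1` at the End-orbit point
`x_last^m = det_m(diagToLast · x)`, while `I(GL·det_m)` is the kernel of the generic orbit map. -/
theorem X_dLast_pow_not_mem_orbitVanishingIdeal (δ : ℕ) :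
    ((X (dLast m) : MvPolynomial (DegIdx (MatIdx m) m) ℂ) ^ δ) ∉ orbitVanishingIdeal (detFormLex ℂ m) m := by
  classical
  intro hmem
  have hker : genericOrbitMap (detFormLex ℂ m) m ((X (dLast m)) ^ δ) = 0 := by
    rw [orbitVanishingIdeal_eq_ker_genericOrbitMap, RingHom.mem_ker] at hmem
    exact hmem
  have h := eval_genericOrbitMap (detFormLex ℂ m) m ((X (dLast m)) ^ δ) (diagToLast m ℂ)
  rw [hker, map_zero, linSubst_diagToLast_detFormLex, map_pow, aeval_X, formCoeff_apply, dLast_val] at h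
  have hc : coeff (Finsupp.single (iLast m) m) ((X (iLast m) : MvPolynomial (MatIdx m) ℂ) ^ m) = 1 := by
    rw [X_pow_eq_monomial, coeff_monomial, if_pos rfl]
  rw [hc, one_pow] at h
  exact zero_ne_one h

/-- FiniteDimensionality of the highest-weight spaces of `ℂ[Δ(det_m)]` (tree fact, discharged). -/
instance finiteDimensional_hw (χ : Weight (MatIdx m)) :
    FiniteDimensional ℂ (highestWeightSpace (orbitCoordRep (detFormLex ℂ m) m) χ) :=
  finiteDimensional_highestWeightSpace_orbitCoordRep_holds (detFormLex ℂ m) (NeZero.ne m) χ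

/-- **ENGINE. `1 ≤ K_m((0,…,0,-mδ))`**: the weight `(mδ)*` occurs in `ℂ[Δ(det_m)]` for every
`m ≥ 1` and every `δ` (witness: the class of `X_{x_last^m}^δ`). -/
theorem one_le_orbitMultiplicity_det_lastWeight (δ : ℕ) :
    1 ≤ orbitMultiplicity ℂ (detFormLex ℂ m) m (lastWeight m (m * δ)) := by
  rw [orbitMultiplicity, hwMultiplicity, Nat.one_le_iff_ne_zero, ← Nat.pos_iff_ne_zero,
    Module.finrank_pos_iff_exists_ne_zero]
  refine ⟨⟨_, mk_X_dLast_pow_mem_highestWeightSpace m (detFormLex ℂ m) δ⟩, ?_⟩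
  intro h
  have h' := congrArg Subtype.val h
  simp only [Submodule.coe_zero] at h'
  exact X_dLast_pow_not_mem_orbitVanishingIdeal m δ (Ideal.Quotient.eq_zero_iff_mem.mp h')

/-- The lexicographic enumeration sends the last index of `Fin (m*m)` to `iLast m`
(order isomorphisms preserve greatest elements). -/
theorem val_matIdxEquiv_symm_iLast : (((matIdxEquiv m).symm (iLast m) : Fin (m * m)) : ℕ) = m * m - 1 := by
  have hmm : 0 < m * m := Nat.mul_pos (NeZero.pos m) (NeZero.pos m)
  set a₀ : Fin (m * m) := ⟨m * m - 1, Nat.sub_one_lt hmm.ne'⟩ with ha₀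
  have h1 : (matIdxEquiv m).symm (iLast m) ≤ a₀ :=
    Fin.le_def.mpr (by have := ((matIdxEquiv m).symm (iLast m)).isLt; simp [ha₀]; omega)
  have h2 : a₀ ≤ (matIdxEquiv m).symm (iLast m) := by
    have := (matIdxEquiv m).symm.monotone (le_iLast m (matIdxEquiv m a₀))
    rwa [OrderIso.symm_apply_apply] at this
  rw [le_antisymm h1 h2]

/-- Partitions of `0` have no parts. -/
theorem sortedParts_eq_nil_of_eq_zero {n : ℕ} (hn : n = 0) (μ : Nat.Partition n) : μ.sortedParts = [] := by
  subst hn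
  simp [Nat.Partition.sortedParts, Nat.Partition.partition_zero_parts]

/-- The crux's weight `(dualOfPartition (m*m) (mδ)).toMatIdx` of the one-row partition `(mδ)` IS
`lastWeight m (mδ)`. -/
theorem toMatIdx_dualOfPartition_indiscrete (δ : ℕ) :
    (Weight.dualOfPartition (m * m) (Nat.Partition.indiscrete (m * δ))).toMatIdx = lastWeight m (m * δ) := by
  funext i
  simp only [Weight.toMatIdx, lastWeight, Weight.dualOfPartition, Weight.dual, Weight.ofPartition_apply]
  by_cases hδ : m * δ = 0
  · rw [sortedParts_eq_nil_of_eq_zero hδ, hδ]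
    simp
  · rw [sortedParts_indiscrete hδ]
    have hrev : ∀ j : Fin (m * m), ((Fin.rev j : Fin (m * m)) : ℕ) = 0 ↔ (j : ℕ) = m * m - 1 := by
      intro j
      have := j.isLt
      simp [Fin.rev]
      omega
    by_cases hi : i = iLast m
    · subst hi
      have h0 : ((Fin.rev ((matIdxEquiv m).symm (iLast m)) : Fin (m * m)) : ℕ) = 0 :=
        (hrev _).mpr (val_matIdxEquiv_symm_iLast m)
      rw [if_pos rfl, h0]
      simp
    · rw [if_neg hi]
      have hne : ((Fin.rev ((matIdxEquiv m).symm i) : Fin (m * m)) : ℕ) ≠ 0 := by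
        intro h0
        apply hi
        have hv := (hrev _).mp h0
        have : (matIdxEquiv m).symm i = (matIdxEquiv m).symm (iLast m) :=
          Fin.ext (by rw [hv, val_matIdxEquiv_symm_iLast])
        exact (matIdxEquiv m).symm.injective this
      obtain ⟨n, hn⟩ := Nat.exists_eq_succ_of_ne_zero hne
      rw [hn]
      simp

/-- **ENGINE, crux weight form. `1 ≤ K_m((mδ)*)`** with the weight written exactly as in the crux. -/
theorem one_le_orbitMultiplicity_det_indiscrete (δ : ℕ) :
    1 ≤ orbitMultiplicity ℂ (detFormLex ℂ m) m
      (Weight.dualOfPartition (m * m) (Nat.Partition.indiscrete (m * δ))).toMatIdx := by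
  rw [toMatIdx_dualOfPartition_indiscrete]
  exact one_le_orbitMultiplicity_det_lastWeight m δ

/-- The one-row partition has at most `1 ≤ m*m` parts (the crux's guard is met). -/
theorem card_parts_indiscrete_le (n : ℕ) : (Nat.Partition.indiscrete n).parts.card ≤ m * m := by
  have hmm : 1 ≤ m * m := Nat.mul_pos (NeZero.pos m) (NeZero.pos m)
  by_cases hn : n = 0
  · subst hn; simp [Nat.Partition.partition_zero_parts]
  · rw [Nat.Partition.indiscrete_parts hn]; simpa using hmm

end Engine

/-! ## §0  Anchors: the truncation, verbatim, with locus / threshold / degree / weight exposed -/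

section Truncation

variable (m : ℕ)

/-- `L_U` (ROWS, as in the crux): matrices all of whose rows lie in `U`. -/
def rowLocus (U : Submodule ℂ (MatIdx m → ℂ)) : Set (MatIdx m × MatIdx m → ℂ) :=
  {p | ∀ j : MatIdx m, (fun i => p (j, i)) ∈ U}

/-- The COLUMN variant of `L_U` (NOT the crux's; used for a convention refutation). -/
def colLocus (U : Submodule ℂ (MatIdx m → ℂ)) : Set (MatIdx m × MatIdx m → ℂ) :=
  {p | ∀ i : MatIdx m, (fun j => p (j, i)) ∈ U}

/-- Right-`Stab(det_m)`-invariants `G(A·M) = G(A)` — verbatim the crux's third conjunct. -/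
def stabInvariants : Submodule ℂ (MvPolynomial (MatIdx m × MatIdx m) ℂ) :=
  ⨅ (M : Matrix (MatIdx m) (MatIdx m) ℂ) (_ : linSubst (MatIdx m) ℂ M (detFormLex ℂ m) = detFormLex ℂ m),
    LinearMap.ker ((MvPolynomial.aeval (R := ℂ) fun p : MatIdx m × MatIdx m =>
      ∑ l : MatIdx m, M l p.2 • MvPolynomial.X (p.1, l)).toLinearMap -
      LinearMap.id (R := ℂ) (M := MvPolynomial (MatIdx m × MatIdx m) ℂ))

/-- `B`-semi-invariants of weight `χ` for `G ↦ (A ↦ G(g⁻¹A))` — verbatim the crux's fourth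
conjunct. -/
def borelSemiInvariants (χ : Weight (MatIdx m)) : Submodule ℂ (MvPolynomial (MatIdx m × MatIdx m) ℂ) :=
  ⨅ (g : Matrix.GeneralLinearGroup (MatIdx m) ℂ) (_ : IsUpperTriangular g),
    LinearMap.ker ((MvPolynomial.aeval (R := ℂ) fun p : MatIdx m × MatIdx m =>
      ∑ l : MatIdx m, ((g⁻¹ : Matrix.GeneralLinearGroup (MatIdx m) ℂ) :
        Matrix (MatIdx m) (MatIdx m) ℂ) p.1 l • MvPolynomial.X (l, p.2)).toLinearMap -
      weightChar χ g • LinearMap.id (R := ℂ) (M := MvPolynomial (MatIdx m × MatIdx m) ℂ))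

/-- The valuative truncation `T` with vanishing locus `L`, threshold `t`, degree `n`, weight `χ`:
`Hom_n ⊓ I(L)^t ⊓ Stab-invariants ⊓ B_χ-semi-invariants`. The crux's `T_U(λ)` is
`truncation m (rowLocus m U) (δ*(m-r)) (m*δ) λ*` (`valuativeBound_iff`). -/
def truncation (L : Set (MatIdx m × MatIdx m → ℂ)) (t n : ℕ) (χ : Weight (MatIdx m)) :
    Submodule ℂ (MvPolynomial (MatIdx m × MatIdx m) ℂ) :=
  MvPolynomial.homogeneousSubmodule (MatIdx m × MatIdx m) ℂ n ⊓
    ((MvPolynomial.vanishingIdeal ℂ L) ^ t).restrictScalars ℂ ⊓ stabInvariants m ⊓ borelSemiInvariants m χ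

/-- **Definitional anchor.** The crux, restated through `truncation` — by `Iff.rfl`. Every variant
below changes exactly one argument of this normal form. -/
theorem valuativeBound_iff :
    Summit.ValiantsHypothesis.ValiantsHypothesis.Theses.ValuativeGCT.ValuativeBound ↔
      ∀ (m : ℕ) [NeZero m] (U : Submodule ℂ (MatIdx m → ℂ)) (r : ℕ),
        (∀ u ∈ U, (Matrix.of fun a b : Fin m => u (toLex (a, b))).rank ≤ r) →
        ∀ (δ : ℕ) (lam : Nat.Partition (m * δ)), lam.parts.card ≤ m * m →
          orbitMultiplicity ℂ (detFormLex ℂ m) m (Weight.dualOfPartition (m * m) lam).toMatIdx ≤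
            Module.finrank ℂ (truncation m (rowLocus m U) (δ * (m - r)) (m * δ)
              (Weight.dualOfPartition (m * m) lam).toMatIdx) :=
  Iff.rfl

variable {m}

/-- Membership in the truncation, clause by clause. -/
theorem mem_truncation_iff {L : Set (MatIdx m × MatIdx m → ℂ)} {t n : ℕ} {χ : Weight (MatIdx m)}
    {G : MvPolynomial (MatIdx m × MatIdx m) ℂ} :
    G ∈ truncation m L t n χ ↔ G ∈ MvPolynomial.homogeneousSubmodule (MatIdx m × MatIdx m) ℂ n ∧
      G ∈ (MvPolynomial.vanishingIdeal ℂ L) ^ t ∧ G ∈ stabInvariants m ∧ G ∈ borelSemiInvariants m χ := by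
  simp only [truncation, Submodule.mem_inf, Submodule.restrictScalars_mem, and_assoc]

/-- The Borel clause as a family of substitution identities. -/
theorem mem_borelSemiInvariants_iff {χ : Weight (MatIdx m)} {G : MvPolynomial (MatIdx m × MatIdx m) ℂ} :
    G ∈ borelSemiInvariants m χ ↔ ∀ g : GL (MatIdx m) ℂ, IsUpperTriangular g →
      MvPolynomial.aeval (fun p : MatIdx m × MatIdx m =>
        ∑ l : MatIdx m, ((g⁻¹ : GL (MatIdx m) ℂ) : Matrix (MatIdx m) (MatIdx m) ℂ) p.1 l • X (l, p.2)) G =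
      weightChar χ g • G := by
  simp only [borelSemiInvariants, Submodule.mem_iInf, LinearMap.mem_ker, LinearMap.sub_apply,
    LinearMap.smul_apply, LinearMap.id_apply, AlgHom.toLinearMap_apply, sub_eq_zero]

/-- The Stab clause as a family of substitution identities. -/
theorem mem_stabInvariants_iff {G : MvPolynomial (MatIdx m × MatIdx m) ℂ} :
    G ∈ stabInvariants m ↔ ∀ M : Matrix (MatIdx m) (MatIdx m) ℂ,
      linSubst (MatIdx m) ℂ M (detFormLex ℂ m) = detFormLex ℂ m →
      MvPolynomial.aeval (fun p : MatIdx m × MatIdx m => ∑ l : MatIdx m, M l p.2 • X (p.1, l)) G = G := by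
  simp only [stabInvariants, Submodule.mem_iInf, LinearMap.mem_ker, LinearMap.sub_apply,
    LinearMap.id_apply, AlgHom.toLinearMap_apply, sub_eq_zero]

/-- `L_⊤ = everything` (rows). -/
theorem rowLocus_top : rowLocus m ⊤ = Set.univ := by
  ext p; simp [rowLocus]

/-- Over `ℂ` the only polynomial vanishing everywhere is `0`. -/
theorem vanishingIdeal_univ :
    MvPolynomial.vanishingIdeal ℂ (Set.univ : Set (MatIdx m × MatIdx m → ℂ)) = ⊥ := by
  refine le_antisymm (fun G hG => ?_) bot_le
  rw [MvPolynomial.mem_vanishingIdeal_iff] at hG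
  rw [Ideal.mem_bot]
  apply MvPolynomial.funext
  intro x
  rw [map_zero, ← MvPolynomial.coe_aeval_eq_eval]
  exact hG x (Set.mem_univ x)

/-- **With a positive threshold and the total locus, the truncation is zero.** -/
theorem truncation_univ_eq_bot {t : ℕ} (ht : t ≠ 0) (n : ℕ) (χ : Weight (MatIdx m)) :
    truncation m (Set.univ : Set (MatIdx m × MatIdx m → ℂ)) t n χ = ⊥ := by
  rw [eq_bot_iff]
  intro G hG
  rw [mem_truncation_iff, vanishingIdeal_univ, ← Ideal.zero_eq_bot, zero_pow ht,
    Ideal.zero_eq_bot, Ideal.mem_bot] at hG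
  exact (Submodule.mem_bot ℂ).mpr hG.2.1

end Truncation

/-! ## §2  Load-bearing hypotheses: each one dropped gives a FALSE statement -/

section LoadBearing

/-- **The crux with the rank hypothesis `∀ u ∈ U, rank u ≤ r` DELETED.** -/
def ValuativeBoundWithoutRank : Prop :=
  ∀ (m : ℕ) [NeZero m] (U : Submodule ℂ (MatIdx m → ℂ)) (r : ℕ) (δ : ℕ) (lam : Nat.Partition (m * δ)),
    lam.parts.card ≤ m * m →
      orbitMultiplicity ℂ (detFormLex ℂ m) m (Weight.dualOfPartition (m * m) lam).toMatIdx ≤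
        Module.finrank ℂ (truncation m (rowLocus m U) (δ * (m - r)) (m * δ)
          (Weight.dualOfPartition (m * m) lam).toMatIdx)

/-- **Any proof must use the rank hypothesis**, at every `m ≥ 1`: with it deleted, the instance
`U = ⊤, r = 0, δ = 1, λ = (m)` reads `1 ≤ K_m((m)*) ≤ dim (Hom_m ∩ I(everything)^m ∩ …) = 0`. -/
theorem withoutRank_fails_at (m : ℕ) [NeZero m] :
    ¬ (∀ (U : Submodule ℂ (MatIdx m → ℂ)) (r : ℕ) (δ : ℕ) (lam : Nat.Partition (m * δ)),
      lam.parts.card ≤ m * m →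
        orbitMultiplicity ℂ (detFormLex ℂ m) m (Weight.dualOfPartition (m * m) lam).toMatIdx ≤
          Module.finrank ℂ (truncation m (rowLocus m U) (δ * (m - r)) (m * δ)
            (Weight.dualOfPartition (m * m) lam).toMatIdx)) := by
  intro h
  have h1 := h ⊤ 0 1 (Nat.Partition.indiscrete (m * 1)) (card_parts_indiscrete_le m _)
  rw [rowLocus_top, truncation_univ_eq_bot (by simpa using NeZero.ne m), finrank_bot] at h1
  exact Nat.not_succ_le_zero _ (le_trans (one_le_orbitMultiplicity_det_indiscrete m 1) h1)

/-- **The crux without the rank hypothesis is FALSE.** -/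
theorem valuativeBound_false_without_rank : ¬ ValuativeBoundWithoutRank :=
  fun h => withoutRank_fails_at 1 (h 1)

/-- **The crux with the threshold raised by one**, `t = δ(m-r) + 1` (a natural strengthening). -/
def ValuativeBoundSuccThreshold : Prop :=
  ∀ (m : ℕ) [NeZero m] (U : Submodule ℂ (MatIdx m → ℂ)) (r : ℕ),
    (∀ u ∈ U, (Matrix.of fun a b : Fin m => u (toLex (a, b))).rank ≤ r) →
    ∀ (δ : ℕ) (lam : Nat.Partition (m * δ)), lam.parts.card ≤ m * m →
      orbitMultiplicity ℂ (detFormLex ℂ m) m (Weight.dualOfPartition (m * m) lam).toMatIdx ≤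
        Module.finrank ℂ (truncation m (rowLocus m U) (δ * (m - r) + 1) (m * δ)
          (Weight.dualOfPartition (m * m) lam).toMatIdx)

/-- **The threshold `δ(m-r)` cannot be raised by one**, at every `m ≥ 1`: witness `U = ⊤, r = m`
(every matrix has rank `≤ m`), `δ = 1`, `λ = (m)`: the crux's threshold is `0`, the raised one is
`1`, and `I(everything)^1 = 0` kills `T` while `K_m((m)*) ≥ 1`. (The honest tightness witness —
order of vanishing EXACTLY `δ(m-r)` along `L_U` for `U = 0` — is the `m = 1` computation
`T_0 = ℂ·A^δ`, `A^δ ∉ (A)^(δ+1)`; gen-1 `not_valuativeBoundSharperThreshold`.) -/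
theorem succThreshold_fails_at (m : ℕ) [NeZero m] :
    ¬ (∀ (U : Submodule ℂ (MatIdx m → ℂ)) (r : ℕ),
      (∀ u ∈ U, (Matrix.of fun a b : Fin m => u (toLex (a, b))).rank ≤ r) →
      ∀ (δ : ℕ) (lam : Nat.Partition (m * δ)), lam.parts.card ≤ m * m →
        orbitMultiplicity ℂ (detFormLex ℂ m) m (Weight.dualOfPartition (m * m) lam).toMatIdx ≤
          Module.finrank ℂ (truncation m (rowLocus m U) (δ * (m - r) + 1) (m * δ)
            (Weight.dualOfPartition (m * m) lam).toMatIdx)) := by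
  intro h
  have h1 := h ⊤ m (fun u _ => Matrix.rank_le_width _) 1 (Nat.Partition.indiscrete (m * 1))
    (card_parts_indiscrete_le m _)
  rw [rowLocus_top, truncation_univ_eq_bot (by simp), finrank_bot] at h1
  exact Nat.not_succ_le_zero _ (le_trans (one_le_orbitMultiplicity_det_indiscrete m 1) h1)

/-- **The crux with threshold `δ(m-r)+1` is FALSE.** -/
theorem valuativeBound_false_succ_threshold : ¬ ValuativeBoundSuccThreshold :=
  fun h => succThreshold_fails_at 1 (h 1)


/-! ### The scalar torus: degree versus weight size -/

section Scalar

variable {m : ℕ}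

/-- The inverse of the torus element `diag(x)` is `diag(x⁻¹)`. -/
theorem coe_inv_torusElt {σ k : Type*} [Fintype σ] [LinearOrder σ] [Field k] (x : σ → k)
    (hx : ∀ i, x i ≠ 0) :
    (((torusElt x hx)⁻¹ : GL σ k) : Matrix σ σ k) = Matrix.diagonal fun i => (x i)⁻¹ := by
  have h : (torusElt x hx : GL σ k) * torusElt (fun i => (x i)⁻¹) (fun i => inv_ne_zero (hx i)) = 1 := by
    ext1
    rw [Units.val_mul, coe_torusElt, coe_torusElt, Matrix.diagonal_mul_diagonal, Units.val_one,
      ← Matrix.diagonal_one]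
    congr 1
    funext i
    exact mul_inv_cancel₀ (hx i)
  rw [inv_eq_of_mul_eq_one_right h, coe_torusElt]

/-- **Homogeneity as a substitution identity**: `G(c·x) = c^n G(x)` for `G ∈ Hom_n`. -/
theorem aeval_smul_X_of_mem_homogeneousSubmodule {σ : Type*} [Fintype σ] [DecidableEq σ]
    {G : MvPolynomial σ ℂ} {n : ℕ} (hG : G ∈ MvPolynomial.homogeneousSubmodule σ ℂ n) (c : ℂ) :
    MvPolynomial.aeval (fun p : σ => c • (X p : MvPolynomial σ ℂ)) G = c ^ n • G := by
  classical
  have hlin : (MvPolynomial.aeval fun p : σ => c • (X p : MvPolynomial σ ℂ)) =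
      linSubst σ ℂ (Matrix.diagonal fun _ => c) := by
    apply MvPolynomial.algHom_ext
    intro p
    rw [aeval_X, linSubst_X, Finset.sum_eq_single p (fun j _ hj => by
      rw [Matrix.diagonal_apply_ne _ hj, zero_smul]) (fun h => absurd (Finset.mem_univ p) h),
      Matrix.diagonal_apply_eq]
  rw [hlin]
  conv_lhs => rw [G.as_sum]
  rw [map_sum]
  conv_rhs => rw [G.as_sum]
  rw [Finset.smul_sum]
  refine Finset.sum_congr rfl fun e he => ?_
  rw [linSubst_diagonal_monomial]
  congr 1
  have hdeg : e.degree = n := by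
    rw [Finsupp.degree_eq_weight_one]
    exact (mem_homogeneousSubmodule n G).mp hG (mem_support_iff.mp he)
  rw [Finsupp.prod, Finset.prod_pow_eq_pow_sum, ← hdeg, Finsupp.degree_apply]

/-- **The scalar clause.** For a `B`-semi-invariant `G` of weight `χ` with `∑ χ = -s`, the scalar
`c⁻¹·1 ∈ B` gives `G(c·x) = c^s G(x)`. -/
theorem aeval_smul_X_of_mem_borelSemiInvariants {χ : Weight (MatIdx m)}
    {G : MvPolynomial (MatIdx m × MatIdx m) ℂ} (hB : G ∈ borelSemiInvariants m χ) {s : ℕ}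
    (hs : χ.size = -(s : ℤ)) {c : ℂ} (hc : c ≠ 0) :
    MvPolynomial.aeval (fun p : MatIdx m × MatIdx m => c • (X p : MvPolynomial _ ℂ)) G = c ^ s • G := by
  classical
  set g : GL (MatIdx m) ℂ := torusElt (fun _ : MatIdx m => c⁻¹) (fun _ => inv_ne_zero hc) with hg
  have hgU : IsUpperTriangular g := (isDiagonalGL_torusElt _ _).isUpperTriangular
  have h := (mem_borelSemiInvariants_iff.mp hB) g hgU
  have hfun : (fun p : MatIdx m × MatIdx m => ∑ l : MatIdx m,
      ((g⁻¹ : GL (MatIdx m) ℂ) : Matrix (MatIdx m) (MatIdx m) ℂ) p.1 l • (X (l, p.2) : MvPolynomial _ ℂ)) =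
      fun p => c • X p := by
    funext p
    rw [hg, coe_inv_torusElt, Finset.sum_eq_single p.1 (fun l _ hl => by
      rw [Matrix.diagonal_apply_ne _ (Ne.symm hl), zero_smul]) (fun h => absurd (Finset.mem_univ _) h),
      Matrix.diagonal_apply_eq, inv_inv]
  have hw : weightChar χ g = c ^ s := by
    rw [hg, weightChar_torusElt, prod_zpow_eq_zpow_sum (inv_ne_zero hc)]
    change c⁻¹ ^ χ.size = c ^ s
    rw [hs, zpow_neg, inv_zpow, inv_inv, zpow_natCast]
  rw [hfun, hw] at h
  exact h

/-- Distinct powers of `2` are distinct in `ℂ`. -/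
theorem two_pow_ne_two_pow {n s : ℕ} (h : n ≠ s) : (2 : ℂ) ^ n ≠ (2 : ℂ) ^ s := by
  intro h2
  apply h
  apply Nat.pow_right_injective (le_refl 2)
  exact_mod_cast h2

/-- **DEGREE–SIZE MISMATCH KILLS `T`.** A form of degree `n` that is a `B`-semi-invariant of a
weight of size `-s ≠ -n` is zero (compare the two scalar identities at `c = 2`). This is the Lean
form of "a weight pins the degree" read backwards, and it is what makes the guard
`λ.parts.card ≤ m*m` load-bearing (a truncated weight has the wrong size). -/
theorem eq_zero_of_degree_ne_size {χ : Weight (MatIdx m)} {G : MvPolynomial (MatIdx m × MatIdx m) ℂ}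
    {n s : ℕ} (hG : G ∈ MvPolynomial.homogeneousSubmodule (MatIdx m × MatIdx m) ℂ n)
    (hB : G ∈ borelSemiInvariants m χ) (hs : χ.size = -(s : ℤ)) (hns : n ≠ s) : G = 0 := by
  have h1 := aeval_smul_X_of_mem_homogeneousSubmodule hG (2 : ℂ)
  have h2 := aeval_smul_X_of_mem_borelSemiInvariants hB hs (two_ne_zero)
  rw [h1] at h2
  have h3 : ((2 : ℂ) ^ n - 2 ^ s) • G = 0 := by rw [sub_smul, h2, sub_self]
  rcases smul_eq_zero.mp h3 with h4 | h4
  · exact absurd (sub_eq_zero.mp h4) (two_pow_ne_two_pow hns)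
  · exact h4

/-- With a degree/size mismatch the whole truncation vanishes, whatever `L`, `t`. -/
theorem truncation_eq_bot_of_degree_ne_size (L : Set (MatIdx m × MatIdx m → ℂ)) (t : ℕ)
    {n s : ℕ} {χ : Weight (MatIdx m)} (hs : χ.size = -(s : ℤ)) (hns : n ≠ s) :
    truncation m L t n χ = ⊥ := by
  rw [eq_bot_iff]
  intro G hG
  rw [mem_truncation_iff] at hG
  exact (Submodule.mem_bot ℂ).mpr (eq_zero_of_degree_ne_size hG.1 hG.2.2.2 hs hns)

end Scalar

/-! ### The guard `λ.parts.card ≤ m*m` -/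

section CardGuard

/-- The partition `(1,1) ⊢ 2 = 1·2`: two parts, more than `m*m = 1` slots at `m = 1`. -/
def lamOneOne : Nat.Partition (1 * 2) :=
  Nat.Partition.ofSums (1 * 2) {1, 1} (by norm_num)

/-- The parts of `(1,1)`. -/
theorem lamOneOne_parts : lamOneOne.parts = {1, 1} := by
  simp [lamOneOne, Nat.Partition.ofSums]

/-- `(1,1)` has two parts. -/
theorem card_parts_lamOneOne : lamOneOne.parts.card = 2 := by
  rw [lamOneOne_parts]; rfl

/-- Every sorted part of `(1,1)` is `1`. -/
theorem eq_one_of_mem_sortedParts_lamOneOne {a : ℕ} (ha : a ∈ lamOneOne.sortedParts) : a = 1 := by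
  rw [Nat.Partition.sortedParts, Multiset.mem_sort, lamOneOne_parts] at ha
  simpa using ha

/-- The largest part of `(1,1)` is `1`. -/
theorem getD_sortedParts_lamOneOne_zero : lamOneOne.sortedParts.getD 0 0 = 1 := by
  have hlen : 0 < lamOneOne.sortedParts.length := by
    rw [Nat.Partition.length_sortedParts, card_parts_lamOneOne]; norm_num
  rw [List.getD_eq_getElem _ _ hlen]
  exact eq_one_of_mem_sortedParts_lamOneOne (List.getElem_mem hlen)

/-- At `m = 1` every matrix index is the last one. -/
theorem eq_iLast_one (i : MatIdx 1) : i = iLast 1 := by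
  rw [← toLex_ofLex i, iLast]
  congr 1
  exact Prod.ext (Subsingleton.elim _ _) (Subsingleton.elim _ _)

/-- The TRUNCATED dual weight of `(1,1)` on `GL_1` is `(-1)`: the second part is silently dropped
(the documented junk of `Weight.ofPartition`), so the weight has size `-1` although `|λ| = 2`. -/
theorem toMatIdx_dualOfPartition_lamOneOne :
    (Weight.dualOfPartition (1 * 1) lamOneOne).toMatIdx = lastWeight 1 (1 * 1) := by
  funext i
  obtain rfl := eq_iLast_one i
  simp only [Weight.toMatIdx, lastWeight, if_true]
  have hidx : (matIdxEquiv 1).symm (iLast 1) = ⟨1 * 1 - 1, by norm_num⟩ :=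
    Fin.ext (val_matIdxEquiv_symm_iLast 1)
  rw [hidx, Weight.dualOfPartition_apply_last lamOneOne (by norm_num : 0 < 1 * 1),
    getD_sortedParts_lamOneOne_zero]

/-- **The crux with the guard `λ.parts.card ≤ m*m` DELETED.** -/
def ValuativeBoundWithoutCard : Prop :=
  ∀ (m : ℕ) [NeZero m] (U : Submodule ℂ (MatIdx m → ℂ)) (r : ℕ),
    (∀ u ∈ U, (Matrix.of fun a b : Fin m => u (toLex (a, b))).rank ≤ r) →
    ∀ (δ : ℕ) (lam : Nat.Partition (m * δ)),
      orbitMultiplicity ℂ (detFormLex ℂ m) m (Weight.dualOfPartition (m * m) lam).toMatIdx ≤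
        Module.finrank ℂ (truncation m (rowLocus m U) (δ * (m - r)) (m * δ)
          (Weight.dualOfPartition (m * m) lam).toMatIdx)

/-- **Any proof must use the guard `λ.parts.card ≤ m*m`.** Witness `m = 1`, `U = 0`, `r = 0`,
`δ = 2`, `λ = (1,1)`: the truncated weight is `(-1)` (size `-1`), `K_1((-1)) = 1` (class of the
coordinate `X`), but `T ⊆ Hom_2 ∩ {B-semi-invariants of size -1} = 0` by the degree–size
mismatch (`eq_zero_of_degree_ne_size`). So `1 ≤ 0`. (Same witness as the tree's docstring of
`orbitMultiplicity_det_le_kroneckerCoeff`, l.575–580, and as gen-1's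
`valuativeBound_false_without_card`.) -/
theorem valuativeBound_false_without_card : ¬ ValuativeBoundWithoutCard := by
  intro h
  have h1 := h 1 ⊥ 0 (fun u hu => by
    rw [(Submodule.mem_bot ℂ).mp hu]
    have h0 : (Matrix.of fun a b : Fin 1 => (0 : MatIdx 1 → ℂ) (toLex (a, b))) = 0 := rfl
    rw [h0, Matrix.rank_zero]) 2 lamOneOne
  rw [toMatIdx_dualOfPartition_lamOneOne,
    truncation_eq_bot_of_degree_ne_size (m := 1) (rowLocus 1 ⊥) (2 * (1 - 0)) (n := 1 * 2) (s := 1 * 1)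
      (by simp [Weight.size, lastWeight]) (by norm_num),
    finrank_bot] at h1
  exact Nat.not_succ_le_zero _ (le_trans (one_le_orbitMultiplicity_det_lastWeight 1 1) h1)

end CardGuard

/-! ## §4  Conventions: rows vs columns, side of the Stab action, `g⁻¹` vs `g` -/

section TorusSupport

variable {m : ℕ} [NeZero m]

/-- Coefficients under a diagonal substitution (the tree's `coeff_linSubst_diagonal`, restated
without the `LinearOrder` hypothesis so that it applies to the variable set `MatIdx m × MatIdx m`). -/
theorem coeff_linSubst_diagonal' {σ : Type*} [Fintype σ] [DecidableEq σ] (d : σ → ℂ)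
    (v : MvPolynomial σ ℂ) (e : σ →₀ ℕ) :
    coeff e (linSubst σ ℂ (Matrix.diagonal d) v) = (∏ i, d i ^ e i) * coeff e v := by
  conv_lhs => rw [v.as_sum, map_sum]
  rw [coeff_sum]
  simp only [linSubst_diagonal_monomial, coeff_smul, coeff_monomial, smul_eq_mul]
  rw [Finset.sum_eq_single e]
  · rw [if_pos rfl, Finsupp.prod_fintype _ _ (fun i => pow_zero (d i))]
  · intro e' _ hne
    rw [if_neg hne, mul_zero]
  · intro he
    rw [if_pos rfl, notMem_support_iff.mp he, mul_zero]

omit [NeZero m] in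
/-- The Borel substitution at a torus element `diag(x)` is the diagonal substitution
`X (j,i) ↦ (x j)⁻¹ X (j,i)`. -/
theorem borelFun_torusElt (x : MatIdx m → ℂ) (hx : ∀ j, x j ≠ 0) :
    (fun p : MatIdx m × MatIdx m => ∑ l : MatIdx m,
      (((torusElt x hx)⁻¹ : GL (MatIdx m) ℂ) : Matrix (MatIdx m) (MatIdx m) ℂ) p.1 l •
        (X (l, p.2) : MvPolynomial (MatIdx m × MatIdx m) ℂ)) =
      fun p => (x p.1)⁻¹ • X p := by
  funext p
  rw [coe_inv_torusElt, Finset.sum_eq_single p.1 (fun l _ hl => by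
    rw [Matrix.diagonal_apply_ne _ (Ne.symm hl), zero_smul]) (fun h => absurd (Finset.mem_univ _) h),
    Matrix.diagonal_apply_eq]

/-- A diagonal rescaling of the variables is a `linSubst` by a diagonal matrix. -/
theorem aeval_smul_X_eq_linSubst_diagonal {σ : Type*} [Fintype σ] [DecidableEq σ] (D : σ → ℂ) :
    (MvPolynomial.aeval fun p : σ => D p • (X p : MvPolynomial σ ℂ)) =
      linSubst σ ℂ (Matrix.diagonal D) := by
  apply MvPolynomial.algHom_ext
  intro p
  rw [aeval_X, linSubst_X, Finset.sum_eq_single p (fun j _ hj => by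
    rw [Matrix.diagonal_apply_ne _ hj, zero_smul]) (fun h => absurd (Finset.mem_univ p) h),
    Matrix.diagonal_apply_eq]

/-- **LEMMA R (torus support).** A `B`-semi-invariant of weight `(0,…,0,-n)` involves only the
variables of the LAST ROW `X (iLast, ·)`: test the torus element `diag(1,…,1 | 2⁻¹ off the last
index)`, whose character value is `1`, and compare coefficients (`2^N = 1 ⇒ N = 0`). -/
theorem apply_eq_zero_of_mem_borelSemiInvariants_lastWeight {n : ℕ}
    {G : MvPolynomial (MatIdx m × MatIdx m) ℂ} (hB : G ∈ borelSemiInvariants m (lastWeight m n))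
    {e : MatIdx m × MatIdx m →₀ ℕ} (he : e ∈ G.support) {p : MatIdx m × MatIdx m}
    (hp : p.1 ≠ iLast m) : e p = 0 := by
  classical
  set x : MatIdx m → ℂ := fun j => if j = iLast m then 1 else 2⁻¹ with hxdef
  have hx : ∀ j, x j ≠ 0 := fun j => by
    by_cases hj : j = iLast m <;> simp [hxdef, hj]
  have h := (mem_borelSemiInvariants_iff.mp hB) (torusElt x hx)
    (isDiagonalGL_torusElt x hx).isUpperTriangular
  rw [borelFun_torusElt x hx, weightChar_lastWeight, coe_torusElt, Matrix.diagonal_apply_eq] at h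
  have hx1 : x (iLast m) = 1 := by simp [hxdef]
  rw [hx1, inv_one, one_pow, one_smul, aeval_smul_X_eq_linSubst_diagonal] at h
  -- compare the coefficient of `e`
  have hc := congrArg (coeff e) h
  rw [coeff_linSubst_diagonal'] at hc
  have hce : coeff e G ≠ 0 := mem_support_iff.mp he
  have hprod : (∏ q : MatIdx m × MatIdx m, (x q.1)⁻¹ ^ e q) = 1 := by
    have := mul_right_cancel₀ hce (hc.trans (one_mul _).symm)
    exact this
  -- the product is `2 ^ (∑ over q with q.1 ≠ iLast)`
  have hsplit : (∏ q : MatIdx m × MatIdx m, (x q.1)⁻¹ ^ e q) =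
      2 ^ (∑ q ∈ Finset.univ.filter (fun q : MatIdx m × MatIdx m => q.1 ≠ iLast m), e q) := by
    rw [← Finset.prod_pow_eq_pow_sum,
      ← Finset.prod_filter_mul_prod_filter_not Finset.univ (fun q : MatIdx m × MatIdx m => q.1 ≠ iLast m)]
    rw [Finset.prod_eq_one (s := Finset.univ.filter fun q : MatIdx m × MatIdx m => ¬ q.1 ≠ iLast m)
      (fun q hq => by
        simp only [Finset.mem_filter, Finset.mem_univ, true_and, not_not] at hq
        simp [hxdef, hq]), mul_one]
    refine Finset.prod_congr rfl fun q hq => ?_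
    simp only [Finset.mem_filter, Finset.mem_univ, true_and] at hq
    simp [hxdef, hq]
  rw [hsplit] at hprod
  have hN : (∑ q ∈ Finset.univ.filter (fun q : MatIdx m × MatIdx m => q.1 ≠ iLast m), e q) = 0 := by
    by_contra hN
    exact two_pow_ne_two_pow hN (by rw [hprod, pow_zero])
  exact (Finset.sum_eq_zero_iff.mp hN) p (by simp [hp])

end TorusSupport

section Columns

/-- **The crux with COLUMNS for ROWS in `L_U`** (`colLocus` for `rowLocus`), everything else
verbatim. -/
def ValuativeBoundColumns : Prop :=
  ∀ (m : ℕ) [NeZero m] (U : Submodule ℂ (MatIdx m → ℂ)) (r : ℕ),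
    (∀ u ∈ U, (Matrix.of fun a b : Fin m => u (toLex (a, b))).rank ≤ r) →
    ∀ (δ : ℕ) (lam : Nat.Partition (m * δ)), lam.parts.card ≤ m * m →
      orbitMultiplicity ℂ (detFormLex ℂ m) m (Weight.dualOfPartition (m * m) lam).toMatIdx ≤
        Module.finrank ℂ (truncation m (colLocus m U) (δ * (m - r)) (m * δ)
          (Weight.dualOfPartition (m * m) lam).toMatIdx)

/-- The line `U = ℂ · e_last ⊂ ℂ^{MatIdx 2}` (the matrix unit `E₁₁`), a rank-`≤ 1` space. -/
def lineLast : Submodule ℂ (MatIdx 2 → ℂ) :=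
  ℂ ∙ (Pi.single (iLast 2) (1 : ℂ))

/-- Every element of `ℂ·E₁₁` has rank `≤ 1`. -/
theorem rank_le_one_of_mem_lineLast {u : MatIdx 2 → ℂ} (hu : u ∈ lineLast) :
    (Matrix.of fun a b : Fin 2 => u (toLex (a, b))).rank ≤ 1 := by
  classical
  obtain ⟨c, rfl⟩ := Submodule.mem_span_singleton.mp hu
  have hmat : (Matrix.of fun a b : Fin 2 => (c • (Pi.single (iLast 2) (1 : ℂ) : MatIdx 2 → ℂ)) (toLex (a, b))) =
      Matrix.vecMulVec (fun a : Fin 2 => if a = 1 then c else 0)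
        (fun b : Fin 2 => if b = 1 then (1 : ℂ) else 0) := by
    ext a b
    simp only [Matrix.of_apply, Pi.smul_apply, Pi.single_apply, Matrix.vecMulVec_apply, iLast,
      smul_eq_mul, EmbeddingLike.apply_eq_iff_eq, Prod.mk.injEq]
    have h1 : (⟨2 - 1, Nat.sub_one_lt (NeZero.ne 2)⟩ : Fin 2) = 1 := rfl
    simp only [h1]
    by_cases ha : a = 1 <;> by_cases hb : b = 1 <;> simp [ha, hb]
  rw [hmat]
  exact Matrix.rank_vecMulVec_le _ _

/-- Zeroing every row but the last lands in the column locus of `ℂ·e_last`. -/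
theorem mem_colLocus_lineLast (z : MatIdx 2 × MatIdx 2 → ℂ) :
    (fun p : MatIdx 2 × MatIdx 2 => if p.1 = iLast 2 then z p else 0) ∈ colLocus 2 lineLast := by
  intro i
  have : (fun j : MatIdx 2 => if ((j, i) : MatIdx 2 × MatIdx 2).1 = iLast 2 then z (j, i) else 0) =
      z (iLast 2, i) • (Pi.single (iLast 2) (1 : ℂ) : MatIdx 2 → ℂ) := by
    funext j
    by_cases hj : j = iLast 2
    · subst hj; simp
    · simp [hj]
  rw [this]
  exact Submodule.smul_mem _ _ (Submodule.mem_span_singleton_self _)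

/-- **The column truncation of weight `(2)*` at `U = ℂ·e_last` is ZERO**: a semi-invariant of
weight `(0,0,0,-2)` lives on the last row (Lemma R), and a last-row polynomial vanishing on
`{only the last row is free}` vanishes everywhere. -/
theorem truncation_colLocus_lineLast_eq_bot (t : ℕ) (ht : t ≠ 0) (n N : ℕ) :
    truncation 2 (colLocus 2 lineLast) t n (lastWeight 2 N) = ⊥ := by
  classical
  rw [eq_bot_iff]
  intro G hG
  rw [mem_truncation_iff] at hG
  obtain ⟨-, hV, -, hB⟩ := hG
  have hV1 : G ∈ MvPolynomial.vanishingIdeal ℂ (colLocus 2 lineLast) :=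
    Ideal.pow_le_self ht hV
  rw [MvPolynomial.mem_vanishingIdeal_iff] at hV1
  refine (Submodule.mem_bot ℂ).mpr (MvPolynomial.funext fun z => ?_)
  rw [map_zero]
  set y : MatIdx 2 × MatIdx 2 → ℂ := fun p => if p.1 = iLast 2 then z p else 0 with hy
  have h0 : MvPolynomial.eval y G = 0 := by
    rw [← MvPolynomial.coe_aeval_eq_eval]
    exact hV1 y (mem_colLocus_lineLast z)
  rw [← h0, MvPolynomial.eval_eq', MvPolynomial.eval_eq']
  refine Finset.sum_congr rfl fun e he => ?_
  congr 1
  refine Finset.prod_congr rfl fun p _ => ?_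
  by_cases hp : p.1 = iLast 2
  · simp [hy, hp]
  · rw [apply_eq_zero_of_mem_borelSemiInvariants_lastWeight hB he hp, pow_zero, pow_zero]

/-- **ROWS ARE LOAD-BEARING AT THE CRUX LEVEL (columns variant is FALSE).** Witness `m = 2`,
`U = ℂ·E₁₁` (rank `≤ 1 = r`), `δ = 1`, `λ = (2)`: threshold `1`, `K_2((2)*) ≥ 1`, column
truncation `= 0`.  (Gen-1 had the estimate-level statement `coeffVanishingOrder_false_with_columns`;
this is the crux-level one.  Reason in one line: `det_m(xA) = det(∑_j x_j · row_j(A))` spans the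
ROWS of `A` — tree `linSubst_X : X i ↦ ∑ j, A j i • X j`.) -/
theorem valuativeBound_false_with_columns : ¬ ValuativeBoundColumns := by
  intro h
  have h1 := h 2 lineLast 1 (fun u hu => rank_le_one_of_mem_lineLast hu) 1
    (Nat.Partition.indiscrete (2 * 1)) (card_parts_indiscrete_le 2 _)
  rw [toMatIdx_dualOfPartition_indiscrete 2 1,
    truncation_colLocus_lineLast_eq_bot (1 * (2 - 1)) (by norm_num) (2 * 1) (2 * 1), finrank_bot] at h1
  exact Nat.not_succ_le_zero _ (le_trans (one_le_orbitMultiplicity_det_lastWeight 2 1) h1)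

end Columns

section LeftStab

/-- LEFT-`Stab` invariants `G(M·A) = G(A)` — NOT the crux's clause (which is `G(A·M) = G(A)`):
the substitution is `X (j,i) ↦ ∑ l, M j l • X (l,i)`. -/
def leftStabInvariants (m : ℕ) : Submodule ℂ (MvPolynomial (MatIdx m × MatIdx m) ℂ) :=
  ⨅ (M : Matrix (MatIdx m) (MatIdx m) ℂ) (_ : linSubst (MatIdx m) ℂ M (detFormLex ℂ m) = detFormLex ℂ m),
    LinearMap.ker ((MvPolynomial.aeval (R := ℂ) fun p : MatIdx m × MatIdx m =>
      ∑ l : MatIdx m, M p.1 l • MvPolynomial.X (l, p.2)).toLinearMap -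
      LinearMap.id (R := ℂ) (M := MvPolynomial (MatIdx m × MatIdx m) ℂ))

/-- The truncation with the LEFT-`Stab` clause. -/
def truncationLeft (m : ℕ) (L : Set (MatIdx m × MatIdx m → ℂ)) (t n : ℕ) (χ : Weight (MatIdx m)) :
    Submodule ℂ (MvPolynomial (MatIdx m × MatIdx m) ℂ) :=
  MvPolynomial.homogeneousSubmodule (MatIdx m × MatIdx m) ℂ n ⊓
    ((MvPolynomial.vanishingIdeal ℂ L) ^ t).restrictScalars ℂ ⊓ leftStabInvariants m ⊓ borelSemiInvariants m χ

/-- **The crux with the Stab clause on the WRONG SIDE** (`A ↦ M·A` for `A ↦ A·M`). -/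
def ValuativeBoundLeftStab : Prop :=
  ∀ (m : ℕ) [NeZero m] (U : Submodule ℂ (MatIdx m → ℂ)) (r : ℕ),
    (∀ u ∈ U, (Matrix.of fun a b : Fin m => u (toLex (a, b))).rank ≤ r) →
    ∀ (δ : ℕ) (lam : Nat.Partition (m * δ)), lam.parts.card ≤ m * m →
      orbitMultiplicity ℂ (detFormLex ℂ m) m (Weight.dualOfPartition (m * m) lam).toMatIdx ≤
        Module.finrank ℂ (truncationLeft m (rowLocus m U) (δ * (m - r)) (m * δ)
          (Weight.dualOfPartition (m * m) lam).toMatIdx)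

/-- The left-Stab clause as a family of substitution identities. -/
theorem mem_leftStabInvariants_iff {m : ℕ} {G : MvPolynomial (MatIdx m × MatIdx m) ℂ} :
    G ∈ leftStabInvariants m ↔ ∀ M : Matrix (MatIdx m) (MatIdx m) ℂ,
      linSubst (MatIdx m) ℂ M (detFormLex ℂ m) = detFormLex ℂ m →
      MvPolynomial.aeval (fun p : MatIdx m × MatIdx m => ∑ l : MatIdx m, M p.1 l • X (l, p.2)) G = G := by
  simp only [leftStabInvariants, Submodule.mem_iInf, LinearMap.mem_ker, LinearMap.sub_apply,
    LinearMap.id_apply, AlgHom.toLinearMap_apply, sub_eq_zero]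

/-- The lex-first index `(0,0)` of `MatIdx 2`. -/
def iFirst : MatIdx 2 := toLex (0, 0)

/-- `(0,0) ≠ (1,1)`. -/
theorem iFirst_ne_iLast : iFirst ≠ iLast 2 := by decide

/-- The transposition `(0,0) ↔ (1,1)` of the matrix positions. -/
def swapFL : Equiv.Perm (MatIdx 2) := Equiv.swap iFirst (iLast 2)

/-- Its permutation matrix in the `linSubst` convention: `X i ↦ X (swapFL i)`. -/
def swapMatrix : Matrix (MatIdx 2) (MatIdx 2) ℂ := fun j i => if j = swapFL i then 1 else 0

/-- `swapMatrix` acts on variables by `swapFL`. -/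
theorem linSubst_swapMatrix_X (i : MatIdx 2) :
    linSubst (MatIdx 2) ℂ swapMatrix (X i) = X (swapFL i) := by
  classical
  rw [linSubst_X, Finset.sum_eq_single (swapFL i)]
  · simp [swapMatrix]
  · intro j _ hj
    simp [swapMatrix, hj]
  · intro h; exact absurd (Finset.mem_univ _) h

/-- `det_2 = x₀₀ x₁₁ - x₀₁ x₁₀` in the lex variables. -/
theorem detFormLex_two : detFormLex ℂ 2 =
    X iFirst * X (iLast 2) - X (toLex (0, 1)) * X (toLex (1, 0)) := by
  rw [detFormLex, detPoly, AlgHom.map_det, Matrix.det_fin_two]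
  simp only [AlgHom.mapMatrix_apply, Matrix.map_apply, Matrix.mvPolynomialX_apply, rename_X]
  rfl

/-- **`x ↦ swap(x₀₀, x₁₁)` stabilises `det_2`.** -/
theorem linSubst_swapMatrix_detFormLex :
    linSubst (MatIdx 2) ℂ swapMatrix (detFormLex ℂ 2) = detFormLex ℂ 2 := by
  rw [detFormLex_two]
  simp only [map_sub, map_mul, linSubst_swapMatrix_X]
  have h1 : swapFL iFirst = iLast 2 := Equiv.swap_apply_left _ _
  have h2 : swapFL (iLast 2) = iFirst := Equiv.swap_apply_right _ _
  have h3 : swapFL (toLex (0, 1)) = toLex (0, 1) := Equiv.swap_apply_of_ne_of_ne (by decide) (by decide)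
  have h4 : swapFL (toLex (1, 0)) = toLex (1, 0) := Equiv.swap_apply_of_ne_of_ne (by decide) (by decide)
  rw [h1, h2, h3, h4, mul_comm]

/-- The swap of the ROW index of `End W`. -/
def rowSwap : (MatIdx 2 × MatIdx 2) ≃ (MatIdx 2 × MatIdx 2) :=
  Equiv.prodCongr swapFL (Equiv.refl _)

/-- Unfolding lemma for `rowSwap`. -/
@[simp] theorem rowSwap_apply (p : MatIdx 2 × MatIdx 2) : rowSwap p = (swapFL p.1, p.2) := rfl

/-- The LEFT-`Stab` substitution at the swap matrix is `rename rowSwap`. -/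
theorem aeval_leftFun_swapMatrix :
    (MvPolynomial.aeval fun p : MatIdx 2 × MatIdx 2 =>
      ∑ l : MatIdx 2, swapMatrix p.1 l • (X (l, p.2) : MvPolynomial (MatIdx 2 × MatIdx 2) ℂ)) =
      rename rowSwap := by
  classical
  apply MvPolynomial.algHom_ext
  intro p
  rw [aeval_X, rename_X, rowSwap_apply, Finset.sum_eq_single (swapFL p.1)]
  · simp [swapMatrix, swapFL, Equiv.swap_apply_self]
  · intro l _ hl
    have : swapMatrix p.1 l = 0 := by
      simp only [swapMatrix]
      rw [if_neg]
      intro h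
      apply hl
      rw [h, swapFL, Equiv.swap_apply_self]
    rw [this, zero_smul]
  · intro h; exact absurd (Finset.mem_univ _) h

/-- **The LEFT-Stab truncation of a one-row weight is ZERO in every positive degree** (whatever
the vanishing locus and threshold): Lemma R puts every monomial on the last row; invariance under
the row swap `(0,0) ↔ (1,1)` (which stabilises `det_2`) puts it on the first row too. -/
theorem truncationLeft_lastWeight_eq_bot (L : Set (MatIdx 2 × MatIdx 2 → ℂ)) (t : ℕ) {n : ℕ}
    (hn : n ≠ 0) (N : ℕ) : truncationLeft 2 L t n (lastWeight 2 N) = ⊥ := by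
  classical
  rw [eq_bot_iff]
  intro G hG
  simp only [truncationLeft, Submodule.mem_inf, Submodule.restrictScalars_mem] at hG
  obtain ⟨⟨⟨hH, -⟩, hS⟩, hB⟩ := hG
  have hswap := (mem_leftStabInvariants_iff.mp hS) swapMatrix linSubst_swapMatrix_detFormLex
  rw [aeval_leftFun_swapMatrix] at hswap
  refine (Submodule.mem_bot ℂ).mpr ?_
  by_contra hG0
  obtain ⟨e, he⟩ := Finset.nonempty_iff_ne_empty.mpr (support_eq_empty.not.mpr hG0)
  -- every exponent of `e` vanishes
  have hzero : ∀ p, e p = 0 := by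
    intro p
    by_cases hp : p.1 = iLast 2
    · have he' : Finsupp.mapDomain rowSwap e ∈ G.support := by
        have : Finsupp.mapDomain rowSwap e ∈ (rename rowSwap G).support := by
          rw [support_rename_of_injective rowSwap.injective]
          exact Finset.mem_image_of_mem _ he
        rwa [hswap] at this
      have h := apply_eq_zero_of_mem_borelSemiInvariants_lastWeight hB he' (p := rowSwap p)
        (by rw [rowSwap_apply, hp]; exact (Equiv.swap_apply_right _ _).trans_ne iFirst_ne_iLast)
      rwa [Finsupp.mapDomain_apply rowSwap.injective] at h
    · exact apply_eq_zero_of_mem_borelSemiInvariants_lastWeight hB he hp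
  have hdeg : e.degree = n := by
    rw [Finsupp.degree_eq_weight_one]
    exact (mem_homogeneousSubmodule n G).mp hH (mem_support_iff.mp he)
  apply hn
  rw [← hdeg, Finsupp.degree_eq_sum]
  exact Finset.sum_eq_zero fun p _ => hzero p

/-- **THE SIDE OF THE STAB ACTION IS LOAD-BEARING (left variant is FALSE).** Witness `m = 2`,
`U = ⊤`, `r = 2`, `δ = 1`, `λ = (2)`: threshold `0` (no vanishing condition at all),
`K_2((2)*) ≥ 1`, left truncation `= 0`.  The crux's right action `A ↦ A·M` is the correct
transport: `Φ(F)(A·M) = F(linSubst A (linSubst M det)) = Φ(F)(A)` (tree `linSubst_mul`,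
`eval_orbitCoordToPoly_mul_right`). -/
theorem valuativeBound_false_left_stab : ¬ ValuativeBoundLeftStab := by
  intro h
  have h1 := h 2 ⊤ 2 (fun u _ => Matrix.rank_le_width _) 1 (Nat.Partition.indiscrete (2 * 1))
    (card_parts_indiscrete_le 2 _)
  rw [toMatIdx_dualOfPartition_indiscrete 2 1,
    truncationLeft_lastWeight_eq_bot _ _ (by norm_num) (2 * 1), finrank_bot] at h1
  exact Nat.not_succ_le_zero _ (le_trans (one_le_orbitMultiplicity_det_lastWeight 2 1) h1)

end LeftStab

section BorelNoInverse

variable {m : ℕ}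

/-- `B`-semi-invariants with `g` in place of `g⁻¹` — NOT the crux's clause. -/
def borelSemiInvariantsNoInv (m : ℕ) (χ : Weight (MatIdx m)) :
    Submodule ℂ (MvPolynomial (MatIdx m × MatIdx m) ℂ) :=
  ⨅ (g : Matrix.GeneralLinearGroup (MatIdx m) ℂ) (_ : IsUpperTriangular g),
    LinearMap.ker ((MvPolynomial.aeval (R := ℂ) fun p : MatIdx m × MatIdx m =>
      ∑ l : MatIdx m, ((g : Matrix.GeneralLinearGroup (MatIdx m) ℂ) :
        Matrix (MatIdx m) (MatIdx m) ℂ) p.1 l • MvPolynomial.X (l, p.2)).toLinearMap -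
      weightChar χ g • LinearMap.id (R := ℂ) (M := MvPolynomial (MatIdx m × MatIdx m) ℂ))

/-- The truncation with the `g`-for-`g⁻¹` Borel clause. -/
def truncationNoInv (m : ℕ) (L : Set (MatIdx m × MatIdx m → ℂ)) (t n : ℕ) (χ : Weight (MatIdx m)) :
    Submodule ℂ (MvPolynomial (MatIdx m × MatIdx m) ℂ) :=
  MvPolynomial.homogeneousSubmodule (MatIdx m × MatIdx m) ℂ n ⊓
    ((MvPolynomial.vanishingIdeal ℂ L) ^ t).restrictScalars ℂ ⊓ stabInvariants m ⊓ borelSemiInvariantsNoInv m χ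

/-- **The crux with `G(gA) = χ(g) G(A)` for `G(g⁻¹A) = χ(g) G(A)`.** -/
def ValuativeBoundBorelNoInv : Prop :=
  ∀ (m : ℕ) [NeZero m] (U : Submodule ℂ (MatIdx m → ℂ)) (r : ℕ),
    (∀ u ∈ U, (Matrix.of fun a b : Fin m => u (toLex (a, b))).rank ≤ r) →
    ∀ (δ : ℕ) (lam : Nat.Partition (m * δ)), lam.parts.card ≤ m * m →
      orbitMultiplicity ℂ (detFormLex ℂ m) m (Weight.dualOfPartition (m * m) lam).toMatIdx ≤
        Module.finrank ℂ (truncationNoInv m (rowLocus m U) (δ * (m - r)) (m * δ)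
          (Weight.dualOfPartition (m * m) lam).toMatIdx)

/-- The `g`-for-`g⁻¹` clause as a family of substitution identities. -/
theorem mem_borelSemiInvariantsNoInv_iff {χ : Weight (MatIdx m)} {G : MvPolynomial (MatIdx m × MatIdx m) ℂ} :
    G ∈ borelSemiInvariantsNoInv m χ ↔ ∀ g : GL (MatIdx m) ℂ, IsUpperTriangular g →
      MvPolynomial.aeval (fun p : MatIdx m × MatIdx m =>
        ∑ l : MatIdx m, ((g : GL (MatIdx m) ℂ) : Matrix (MatIdx m) (MatIdx m) ℂ) p.1 l • X (l, p.2)) G =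
      weightChar χ g • G := by
  simp only [borelSemiInvariantsNoInv, Submodule.mem_iInf, LinearMap.mem_ker, LinearMap.sub_apply,
    LinearMap.smul_apply, LinearMap.id_apply, AlgHom.toLinearMap_apply, sub_eq_zero]

/-- The scalar clause without the inverse: `G(c·x) = c^{∑χ} G(x) = (c^s)⁻¹ G(x)`. -/
theorem aeval_smul_X_of_mem_borelSemiInvariantsNoInv {χ : Weight (MatIdx m)}
    {G : MvPolynomial (MatIdx m × MatIdx m) ℂ} (hB : G ∈ borelSemiInvariantsNoInv m χ) {s : ℕ}
    (hs : χ.size = -(s : ℤ)) {c : ℂ} (hc : c ≠ 0) :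
    MvPolynomial.aeval (fun p : MatIdx m × MatIdx m => c • (X p : MvPolynomial _ ℂ)) G = (c ^ s)⁻¹ • G := by
  classical
  set g : GL (MatIdx m) ℂ := torusElt (fun _ : MatIdx m => c) (fun _ => hc) with hg
  have hgU : IsUpperTriangular g := (isDiagonalGL_torusElt _ _).isUpperTriangular
  have h := (mem_borelSemiInvariantsNoInv_iff.mp hB) g hgU
  have hfun : (fun p : MatIdx m × MatIdx m => ∑ l : MatIdx m,
      ((g : GL (MatIdx m) ℂ) : Matrix (MatIdx m) (MatIdx m) ℂ) p.1 l • (X (l, p.2) : MvPolynomial _ ℂ)) =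
      fun p => c • X p := by
    funext p
    rw [hg, coe_torusElt, Finset.sum_eq_single p.1 (fun l _ hl => by
      rw [Matrix.diagonal_apply_ne _ (Ne.symm hl), zero_smul]) (fun h => absurd (Finset.mem_univ _) h),
      Matrix.diagonal_apply_eq]
  have hw : weightChar χ g = (c ^ s)⁻¹ := by
    rw [hg, weightChar_torusElt, prod_zpow_eq_zpow_sum hc]
    change c ^ χ.size = (c ^ s)⁻¹
    rw [hs, zpow_neg, zpow_natCast]
  rw [hfun, hw] at h
  exact h

/-- **With `g` for `g⁻¹` the truncation is ZERO as soon as degree + |weight| > 0**: the scalar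
`2·1 ∈ B` acts by `2^n` (homogeneity) and by `2^{-s}` (the clause), and `2^n ≠ 2^{-s}`. -/
theorem truncationNoInv_eq_bot (L : Set (MatIdx m × MatIdx m → ℂ)) (t : ℕ) {n s : ℕ}
    {χ : Weight (MatIdx m)} (hs : χ.size = -(s : ℤ)) (hns : n + s ≠ 0) :
    truncationNoInv m L t n χ = ⊥ := by
  rw [eq_bot_iff]
  intro G hG
  simp only [truncationNoInv, Submodule.mem_inf, Submodule.restrictScalars_mem] at hG
  obtain ⟨⟨⟨hH, -⟩, -⟩, hB⟩ := hG
  have h1 := aeval_smul_X_of_mem_homogeneousSubmodule hH (2 : ℂ)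
  have h2 := aeval_smul_X_of_mem_borelSemiInvariantsNoInv hB hs (two_ne_zero)
  rw [h1] at h2
  have h3 : ((2 : ℂ) ^ n - ((2 : ℂ) ^ s)⁻¹) • G = 0 := by rw [sub_smul, h2, sub_self]
  refine (Submodule.mem_bot ℂ).mpr ?_
  rcases smul_eq_zero.mp h3 with h4 | h4
  · exfalso
    have h5 : (2 : ℂ) ^ n * 2 ^ s = 1 := by
      rw [sub_eq_zero.mp h4, inv_mul_cancel₀ (pow_ne_zero _ two_ne_zero)]
    rw [← pow_add] at h5
    exact two_pow_ne_two_pow hns (h5.trans (pow_zero _).symm)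
  · exact h4

/-- **THE INVERSE IN THE BOREL CLAUSE IS LOAD-BEARING (`g`-for-`g⁻¹` variant is FALSE)**, at
every `m ≥ 1`: witness `U = ⊤`, `r = m`, `δ = 1`, `λ = (m)` (threshold `0`): `K_m((m)*) ≥ 1` but
the variant truncation is `0` (`n = s = m`).  The crux's `g⁻¹` is the correct transport of
`coordRep` (`(g·F)(v) = F(g⁻¹v)`, tree `aeval_formCoeff_coordSubst`): polynomial functions carry
the DUAL (nonpositive) weights, and `G(g⁻¹A)` with `weightChar χ g`, `χ ≤ 0`, is consistent with
polynomiality while `G(gA)` is not. -/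
theorem borelNoInv_fails_at (m : ℕ) [NeZero m] :
    ¬ (∀ (U : Submodule ℂ (MatIdx m → ℂ)) (r : ℕ),
      (∀ u ∈ U, (Matrix.of fun a b : Fin m => u (toLex (a, b))).rank ≤ r) →
      ∀ (δ : ℕ) (lam : Nat.Partition (m * δ)), lam.parts.card ≤ m * m →
        orbitMultiplicity ℂ (detFormLex ℂ m) m (Weight.dualOfPartition (m * m) lam).toMatIdx ≤
          Module.finrank ℂ (truncationNoInv m (rowLocus m U) (δ * (m - r)) (m * δ)
            (Weight.dualOfPartition (m * m) lam).toMatIdx)) := by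
  intro h
  have h1 := h ⊤ m (fun u _ => Matrix.rank_le_width _) 1 (Nat.Partition.indiscrete (m * 1))
    (card_parts_indiscrete_le m _)
  have hsize : (lastWeight m (m * 1)).size = -((m * 1 : ℕ) : ℤ) := by
    classical
    simp [Weight.size, lastWeight, Finset.sum_ite_eq']
  rw [toMatIdx_dualOfPartition_indiscrete m 1,
    truncationNoInv_eq_bot _ _ hsize (by simpa using NeZero.ne m), finrank_bot] at h1
  exact Nat.not_succ_le_zero _ (le_trans (one_le_orbitMultiplicity_det_lastWeight m 1) h1)

/-- **The crux with `g` for `g⁻¹` in the Borel clause is FALSE.** -/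
theorem valuativeBound_false_borel_no_inv : ¬ ValuativeBoundBorelNoInv :=
  fun h => borelNoInv_fails_at 1 (h 1)

end BorelNoInverse

/-! ## §3'  Tightness at `m = 1`: the truncation is EXACTLY `ℂ·A^δ`, the bound is attained,
the strict variant is false, and `T` has a non-junk inhabitant -/

section TightAtOne

/-- A sum over `MatIdx 1` is its single term. -/
theorem sum_matIdx_one {α : Type*} [AddCommMonoid α] (f : MatIdx 1 → α) : ∑ l, f l = f (iLast 1) :=
  Finset.sum_eq_single (iLast 1) (fun l _ hl => absurd (eq_iLast_one l) hl)
    (fun h => absurd (Finset.mem_univ _) h)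

/-- The unique variable of `End(ℂ¹)`: the entry `A_{00}`. -/
def pOne : MatIdx 1 × MatIdx 1 := (iLast 1, iLast 1)

/-- `MatIdx 1 × MatIdx 1` has a single element. -/
theorem eq_pOne (p : MatIdx 1 × MatIdx 1) : p = pOne :=
  Prod.ext (eq_iLast_one _) (eq_iLast_one _)

/-- `det_1 = x`. -/
theorem detFormLex_one : detFormLex ℂ 1 = X (iLast 1) := by
  rw [detFormLex, detPoly, AlgHom.map_det, Matrix.det_fin_one]
  simp only [AlgHom.mapMatrix_apply, Matrix.map_apply, Matrix.mvPolynomialX_apply, rename_X]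
  rw [eq_iLast_one (toLex (0, 0))]

/-- The End-stabiliser of `det_1 = x` is trivial: `M·x = x ⇒ M₀₀ = 1`. -/
theorem apply_eq_one_of_linSubst_detFormLex_one {M : Matrix (MatIdx 1) (MatIdx 1) ℂ}
    (hM : linSubst (MatIdx 1) ℂ M (detFormLex ℂ 1) = detFormLex ℂ 1) : M (iLast 1) (iLast 1) = 1 := by
  rw [detFormLex_one, linSubst_X, sum_matIdx_one] at hM
  have h := congrArg (coeff (Finsupp.single (iLast 1) 1)) hM
  rw [coeff_smul, smul_eq_mul] at h
  simpa using h

/-- **Non-junk inhabitant of `T`.** At `m = 1`, `U = 0` (`r = 0`, threshold `δ`), the monomial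
`A^δ` lies in the crux's truncation of weight `(δ)* = (-δ)`: it is homogeneous of degree `δ`,
vanishes to order `δ` at `L_0 = {0}`, is fixed by the (trivial) stabiliser of `det_1`, and
`(g⁻¹A)^δ = g^{-δ} A^δ`. -/
theorem X_pow_mem_truncation_one (δ : ℕ) :
    (X pOne : MvPolynomial (MatIdx 1 × MatIdx 1) ℂ) ^ δ ∈
      truncation 1 (rowLocus 1 ⊥) δ δ (lastWeight 1 δ) := by
  classical
  rw [mem_truncation_iff]
  refine ⟨?_, ?_, ?_, ?_⟩
  · exact (mem_homogeneousSubmodule δ _).mpr (isHomogeneous_X_pow _ _)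
  · apply Ideal.pow_mem_pow
    rw [MvPolynomial.mem_vanishingIdeal_iff]
    intro x hx
    rw [aeval_X]
    have h := hx (iLast 1)
    rw [Submodule.mem_bot] at h
    exact congrFun h (iLast 1)
  · rw [mem_stabInvariants_iff]
    intro M hM
    rw [map_pow, aeval_X, sum_matIdx_one]
    change (M (iLast 1) (iLast 1) • (X (iLast 1, iLast 1) : MvPolynomial (MatIdx 1 × MatIdx 1) ℂ)) ^ δ =
      X (iLast 1, iLast 1) ^ δ
    rw [apply_eq_one_of_linSubst_detFormLex_one hM, one_smul]
  · rw [mem_borelSemiInvariants_iff]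
    intro g hg
    rw [map_pow, aeval_X, sum_matIdx_one]
    change (((g⁻¹ : GL (MatIdx 1) ℂ) : Matrix (MatIdx 1) (MatIdx 1) ℂ) (iLast 1) (iLast 1) •
        (X (iLast 1, iLast 1) : MvPolynomial (MatIdx 1 × MatIdx 1) ℂ)) ^ δ =
      weightChar (lastWeight 1 δ) g • X (iLast 1, iLast 1) ^ δ
    rw [inv_apply_diag_of_isUpperTriangular' hg, smul_pow, weightChar_lastWeight]

/-- **`T ⊆ ℂ·A^n` at `m = 1`** (one variable: a form of degree `n` is a multiple of `A^n`),
whatever the locus, threshold and weight. -/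
theorem truncation_one_le_span (L : Set (MatIdx 1 × MatIdx 1 → ℂ)) (t n : ℕ) (χ : Weight (MatIdx 1)) :
    truncation 1 L t n χ ≤ ℂ ∙ ((X pOne : MvPolynomial (MatIdx 1 × MatIdx 1) ℂ) ^ n) := by
  classical
  intro G hG
  rw [mem_truncation_iff] at hG
  obtain ⟨hH, -, -, -⟩ := hG
  rw [Submodule.mem_span_singleton]
  refine ⟨coeff (Finsupp.single pOne n) G, ?_⟩
  have hsupp : ∀ e ∈ G.support, e = Finsupp.single pOne n := by
    intro e he
    have hdeg : e.degree = n := by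
      rw [Finsupp.degree_eq_weight_one]
      exact (mem_homogeneousSubmodule n G).mp hH (mem_support_iff.mp he)
    have he1 : e = Finsupp.single pOne (e pOne) := by
      ext q
      rw [eq_pOne q, Finsupp.single_eq_same]
    rw [he1] at hdeg ⊢
    rw [Finsupp.degree_single] at hdeg
    rw [hdeg]
  conv_rhs => rw [G.as_sum]
  rw [Finset.sum_subset (Finset.subset_singleton_iff'.mpr hsupp) (fun e _ he => by
    rw [notMem_support_iff.mp he, monomial_zero]), Finset.sum_singleton, X_pow_eq_monomial,
    smul_monomial, smul_eq_mul, mul_one]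

/-- **`dim T = 1` at `m = 1`, `U = 0`, for every `δ`.** -/
theorem finrank_truncation_one (δ : ℕ) :
    Module.finrank ℂ (truncation 1 (rowLocus 1 ⊥) δ δ (lastWeight 1 δ)) = 1 := by
  classical
  have hle := truncation_one_le_span (rowLocus 1 ⊥) δ δ (lastWeight 1 δ)
  haveI : FiniteDimensional ℂ (ℂ ∙ ((X pOne : MvPolynomial (MatIdx 1 × MatIdx 1) ℂ) ^ δ)) :=
    FiniteDimensional.span_singleton ℂ _
  haveI : FiniteDimensional ℂ (truncation 1 (rowLocus 1 ⊥) δ δ (lastWeight 1 δ)) :=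
    Submodule.finiteDimensional_of_le hle
  apply le_antisymm
  · exact (Submodule.finrank_mono hle).trans (finrank_span_singleton (pow_ne_zero δ (X_ne_zero pOne))).le
  · rw [Nat.one_le_iff_ne_zero, ← Nat.pos_iff_ne_zero, Module.finrank_pos_iff_exists_ne_zero]
    refine ⟨⟨_, X_pow_mem_truncation_one δ⟩, fun h => ?_⟩
    have h' := congrArg Subtype.val h
    simp only [Submodule.coe_zero] at h'
    exact pow_ne_zero δ (X_ne_zero pOne) h'

/-- **THE BOUND IS ATTAINED at `m = 1`** (for every `δ`): `dim T_0((δ)*) = 1 ≤ K_1((δ)*)`, so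
given the crux both sides are `1` — the constant in `K ≤ dim T` cannot be improved. -/
theorem finrank_truncation_one_le_orbitMultiplicity (δ : ℕ) :
    Module.finrank ℂ (truncation 1 (rowLocus 1 ⊥) δ δ (lastWeight 1 δ)) ≤
      orbitMultiplicity ℂ (detFormLex ℂ 1) 1 (lastWeight 1 (1 * δ)) := by
  rw [finrank_truncation_one]
  exact one_le_orbitMultiplicity_det_lastWeight 1 δ

/-- **The crux with STRICT inequality** (a strengthening). -/
def ValuativeBoundStrict : Prop :=
  ∀ (m : ℕ) [NeZero m] (U : Submodule ℂ (MatIdx m → ℂ)) (r : ℕ),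
    (∀ u ∈ U, (Matrix.of fun a b : Fin m => u (toLex (a, b))).rank ≤ r) →
    ∀ (δ : ℕ) (lam : Nat.Partition (m * δ)), lam.parts.card ≤ m * m →
      orbitMultiplicity ℂ (detFormLex ℂ m) m (Weight.dualOfPartition (m * m) lam).toMatIdx <
        Module.finrank ℂ (truncation m (rowLocus m U) (δ * (m - r)) (m * δ)
          (Weight.dualOfPartition (m * m) lam).toMatIdx)

/-- **The strict variant is FALSE** (tightness): `m = 1`, `U = 0`, `r = 0`, `δ = 1`, `λ = (1)`:
`K_1 ≥ 1 = dim T`. -/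
theorem valuativeBound_false_strict : ¬ ValuativeBoundStrict := by
  intro h
  have h1 := h 1 ⊥ 0 (fun u hu => by
    rw [(Submodule.mem_bot ℂ).mp hu]
    have h0 : (Matrix.of fun a b : Fin 1 => (0 : MatIdx 1 → ℂ) (toLex (a, b))) = 0 := rfl
    rw [h0, Matrix.rank_zero]) 1 (Nat.Partition.indiscrete (1 * 1)) (card_parts_indiscrete_le 1 _)
  rw [toMatIdx_dualOfPartition_indiscrete 1 1] at h1
  have h2 : Module.finrank ℂ (truncation 1 (rowLocus 1 ⊥) (1 * (1 - 0)) (1 * 1) (lastWeight 1 (1 * 1))) = 1 :=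
    finrank_truncation_one 1
  rw [h2] at h1
  exact absurd (one_le_orbitMultiplicity_det_lastWeight 1 1) (not_le.mpr h1)

end TightAtOne

end LoadBearing

/-! ## §5  Tightness on EVERY one-row shape, EVERY `m ≥ 1` (cycle 3): `dim T_U((mδ)) ≤ 1 ≤ K_m((mδ)*)`
for every locus and threshold — no first fundamental theorem needed -/

section TightOneRow

variable {m : ℕ}

/-! ### Matrices as points of `MatIdx m → ℂ` -/

/-- A matrix as a point of the coefficient space `MatIdx m → ℂ`. -/
def vecOf (A : Matrix (Fin m) (Fin m) ℂ) : MatIdx m → ℂ := fun i => A (ofLex i).1 (ofLex i).2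

/-- A point of `MatIdx m → ℂ` as a matrix. -/
def matOf (x : MatIdx m → ℂ) : Matrix (Fin m) (Fin m) ℂ := Matrix.of fun a b => x (toLex (a, b))

/-- Unfolding `vecOf` at a matrix position. -/
@[simp] theorem vecOf_toLex (A : Matrix (Fin m) (Fin m) ℂ) (a b : Fin m) :
    vecOf A (toLex (a, b)) = A a b := rfl

/-- Unfolding `matOf`. -/
@[simp] theorem matOf_apply (x : MatIdx m → ℂ) (a b : Fin m) : matOf x a b = x (toLex (a, b)) := rfl

/-- `vecOf ∘ matOf = id`. -/
theorem vecOf_matOf (x : MatIdx m → ℂ) : vecOf (matOf x) = x := by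
  funext i
  rw [← toLex_ofLex i, vecOf_toLex, matOf_apply]

/-- `det_m` evaluates to the determinant. -/
theorem eval_detFormLex (x : MatIdx m → ℂ) : eval x (detFormLex ℂ m) = (matOf x).det := by
  rw [detFormLex, eval_rename, eval_detPoly]
  rfl

/-- `det_m ≠ 0` (it is `1` at the identity matrix). -/
theorem detFormLex_ne_zero : detFormLex ℂ m ≠ 0 := by
  intro h
  have h1 := eval_detFormLex (vecOf (1 : Matrix (Fin m) (Fin m) ℂ))
  rw [h, map_zero] at h1
  have h2 : matOf (vecOf (1 : Matrix (Fin m) (Fin m) ℂ)) = 1 := by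
    ext a b; rfl
  rw [h2, Matrix.det_one] at h1
  exact zero_ne_one h1

/-- A sum over `MatIdx m` as a double sum over matrix positions. -/
theorem sum_matIdx {α : Type*} [AddCommMonoid α] (F : MatIdx m → α) :
    ∑ j : MatIdx m, F j = ∑ a : Fin m, ∑ b : Fin m, F (toLex (a, b)) := by
  rw [← Fintype.sum_prod_type']
  exact Fintype.sum_equiv toLex.symm _ _ (fun j => by
    rw [← toLex_ofLex j]
    rfl)

/-! ### The left multiplication substitutions `x ↦ P · x` lie in `Stab(det_m)` for `det P = 1` -/

/-- The substitution matrix of `x ↦ P · x` (matrix product, `x` the generic `m × m` matrix). -/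
def rowOp (P : Matrix (Fin m) (Fin m) ℂ) : Matrix (MatIdx m) (MatIdx m) ℂ :=
  fun j i => if (ofLex j).2 = (ofLex i).2 then P (ofLex i).1 (ofLex j).1 else 0

/-- `rowOp P` sends the variable `x_{ab}` to `∑_{a'} P_{a a'} x_{a' b} = (P·x)_{ab}`. -/
theorem linSubst_rowOp_X (P : Matrix (Fin m) (Fin m) ℂ) (a b : Fin m) :
    linSubst (MatIdx m) ℂ (rowOp P) (X (toLex (a, b))) =
      ∑ a' : Fin m, P a a' • (X (toLex (a', b)) : MvPolynomial (MatIdx m) ℂ) := by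
  rw [linSubst_X, sum_matIdx]
  refine Finset.sum_congr rfl fun a' _ => ?_
  rw [Finset.sum_eq_single b]
  · simp [rowOp]
  · intro b' _ hb'
    simp [rowOp, hb']
  · intro h; exact absurd (Finset.mem_univ _) h

/-- **`det_m(P·x) = det P · det_m(x)`** as a substitution identity. -/
theorem linSubst_rowOp_detFormLex (P : Matrix (Fin m) (Fin m) ℂ) :
    linSubst (MatIdx m) ℂ (rowOp P) (detFormLex ℂ m) = C P.det * detFormLex ℂ m := by
  rw [detFormLex, detPoly, AlgHom.map_det, AlgHom.map_det]
  have hmat : ((linSubst (MatIdx m) ℂ (rowOp P)).mapMatrix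
      ((rename toLex : MvPolynomial (Fin m × Fin m) ℂ →ₐ[ℂ] _).mapMatrix
        (Matrix.mvPolynomialX (Fin m) (Fin m) ℂ))) =
      P.map (C : ℂ →+* MvPolynomial (MatIdx m) ℂ) *
        (rename toLex : MvPolynomial (Fin m × Fin m) ℂ →ₐ[ℂ] _).mapMatrix
          (Matrix.mvPolynomialX (Fin m) (Fin m) ℂ) := by
    ext a b
    simp only [AlgHom.mapMatrix_apply, Matrix.map_apply, Matrix.mvPolynomialX_apply, rename_X,
      linSubst_rowOp_X, Matrix.mul_apply, smul_eq_C_mul]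
  rw [hmat, Matrix.det_mul, ← RingHom.mapMatrix_apply, ← RingHom.map_det]

/-- For `det P = 1` the substitution `x ↦ P·x` stabilises `det_m`. -/
theorem linSubst_rowOp_detFormLex_of_det_eq_one {P : Matrix (Fin m) (Fin m) ℂ} (hP : P.det = 1) :
    linSubst (MatIdx m) ℂ (rowOp P) (detFormLex ℂ m) = detFormLex ℂ m := by
  rw [linSubst_rowOp_detFormLex, hP, map_one, one_mul]

/-- Evaluating a linear substitution. -/
theorem eval_linSubst_eq (M : Matrix (MatIdx m) (MatIdx m) ℂ) (x : MatIdx m → ℂ)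
    (g : MvPolynomial (MatIdx m) ℂ) :
    eval x (linSubst (MatIdx m) ℂ M g) = eval (fun i => ∑ j, M j i * x j) g := by
  have hfun : (fun i => eval x (∑ j, M j i • (X j : MvPolynomial (MatIdx m) ℂ))) =
      fun i => ∑ j, M j i * x j := by
    funext i
    simp only [map_sum, smul_eval, eval_X]
  rw [linSubst, Literature.RingTheory.MvPolynomial.eval_aeval_eq_eval, hfun]

/-- `(x ↦ P·x)` on points: `g(rowOp P · x)` at the matrix `A` is `g` at `P * A`. -/
theorem eval_vecOf_linSubst_rowOp (P A : Matrix (Fin m) (Fin m) ℂ) (g : MvPolynomial (MatIdx m) ℂ) :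
    eval (vecOf A) (linSubst (MatIdx m) ℂ (rowOp P) g) = eval (vecOf (P * A)) g := by
  have hfun : (fun i => ∑ j, rowOp P j i * vecOf A j) = vecOf (P * A) := by
    funext i
    rw [← toLex_ofLex i, ← Prod.mk.eta (p := ofLex i), vecOf_toLex, Matrix.mul_apply, sum_matIdx]
    refine Finset.sum_congr rfl fun a' _ => ?_
    rw [Finset.sum_eq_single (ofLex i).2]
    · simp [rowOp]
    · intro b' _ hb'
      simp [rowOp, hb']
    · intro h; exact absurd (Finset.mem_univ _) h
  rw [eval_linSubst_eq, hfun]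

/-! ### `SL_m`-invariant forms of degree `mδ` on `Mat_m` are multiples of `det_m^δ` -/

section Core

variable [NeZero m]

/-- The last index of `Fin m`. -/
def aLast (m : ℕ) [NeZero m] : Fin m := ⟨m - 1, Nat.sub_one_lt (NeZero.ne m)⟩

/-- `iLast m` is the position `(aLast, aLast)`. -/
theorem iLast_eq_toLex : iLast m = toLex (aLast m, aLast m) := rfl

/-- `diag(1, …, 1, c)`. -/
def cornerDiag (c : ℂ) : Matrix (Fin m) (Fin m) ℂ :=
  Matrix.diagonal fun a => if a = aLast m then c else 1

/-- `det diag(1,…,1,c) = c`. -/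
theorem det_cornerDiag (c : ℂ) : (cornerDiag c : Matrix (Fin m) (Fin m) ℂ).det = c := by
  rw [cornerDiag, Matrix.det_diagonal, Finset.prod_ite_eq']
  simp

/-- `diag(1,…,1,c) · diag(1,…,1,d) = diag(1,…,1,cd)`. -/
theorem cornerDiag_mul_cornerDiag (c d : ℂ) :
    (cornerDiag c : Matrix (Fin m) (Fin m) ℂ) * cornerDiag d = cornerDiag (c * d) := by
  rw [cornerDiag, cornerDiag, cornerDiag, Matrix.diagonal_mul_diagonal]
  congr 1
  funext a
  split_ifs <;> simp

/-- `diag(1,…,1,1) = 1`. -/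
theorem cornerDiag_one : (cornerDiag 1 : Matrix (Fin m) (Fin m) ℂ) = 1 := by
  rw [cornerDiag, ← Matrix.diagonal_one]
  congr 1
  funext a
  split_ifs <;> rfl

/-- Every matrix with `det A ≠ 0` is `P · diag(1,…,1,det A)` with `det P = 1`. -/
theorem exists_eq_mul_cornerDiag {A : Matrix (Fin m) (Fin m) ℂ} (hA : A.det ≠ 0) :
    ∃ P : Matrix (Fin m) (Fin m) ℂ, P.det = 1 ∧ A = P * cornerDiag A.det := by
  refine ⟨A * cornerDiag (A.det)⁻¹, ?_, ?_⟩
  · rw [Matrix.det_mul, det_cornerDiag, mul_inv_cancel₀ hA]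
  · rw [Matrix.mul_assoc, cornerDiag_mul_cornerDiag, inv_mul_cancel₀ hA, cornerDiag_one, Matrix.mul_one]

/-- The substitution `x ↦ diag(1, …, 1, det_m(x))` (polynomial-valued). -/
noncomputable def cornerSubst (m : ℕ) [NeZero m] : MatIdx m → MvPolynomial (MatIdx m) ℂ :=
  fun i => if i = iLast m then detFormLex ℂ m else if (ofLex i).1 = (ofLex i).2 then 1 else 0

/-- The same substitution with a formal variable in the corner (univariate). -/
noncomputable def cornerSubstU (m : ℕ) [NeZero m] : MatIdx m → Polynomial ℂ :=
  fun i => if i = iLast m then Polynomial.X else if (ofLex i).1 = (ofLex i).2 then 1 else 0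

/-- The corner substitution evaluated at a point, entrywise. -/
theorem eval_cornerSubst_toLex (x : MatIdx m → ℂ) (a b : Fin m) :
    eval x (cornerSubst m (toLex (a, b))) = (cornerDiag (matOf x).det : Matrix (Fin m) (Fin m) ℂ) a b := by
  simp only [cornerSubst, cornerDiag, iLast_eq_toLex, ofLex_toLex, Matrix.diagonal_apply, toLex_inj,
    Prod.mk.injEq]
  by_cases hab : a = b
  · subst hab
    by_cases ha : a = aLast m
    · rw [if_pos ⟨ha, ha⟩, if_pos rfl, if_pos ha, eval_detFormLex]
    · rw [if_neg (fun h => ha h.1), if_pos rfl, if_pos rfl, if_neg ha, map_one]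
  · rw [if_neg (fun h => hab (h.1.trans h.2.symm)), if_neg hab, if_neg hab, map_zero]

/-- The corner substitution evaluated at a point `x` is the point `diag(1,…,1,det x)`. -/
theorem eval_cornerSubst (x : MatIdx m → ℂ) :
    (fun i => eval x (cornerSubst m i)) = vecOf (cornerDiag (matOf x).det) := by
  funext i
  have h := eval_cornerSubst_toLex x (ofLex i).1 (ofLex i).2
  rw [Prod.mk.eta, toLex_ofLex] at h
  exact h

/-- `g(diag(1,…,1,det_m)) = h(det_m)` for the univariate `h = g(diag(1,…,1,X))`. -/
theorem aeval_cornerSubst_eq (g : MvPolynomial (MatIdx m) ℂ) :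
    aeval (cornerSubst m) g = Polynomial.aeval (detFormLex ℂ m) (aeval (cornerSubstU m) g) := by
  have hs : (fun i => Polynomial.aeval (detFormLex ℂ m) (cornerSubstU m i)) = cornerSubst m := by
    funext i
    simp only [cornerSubst, cornerSubstU]
    split_ifs <;> simp
  rw [comp_aeval_apply, hs]

/-- **Core lemma.** A form of degree `mδ` on `Mat_m` invariant under `x ↦ P·x` for all `P` with
`det P = 1` is a scalar multiple of `det_m^δ`. -/
theorem exists_eq_smul_detFormLex_pow {δ : ℕ} {g : MvPolynomial (MatIdx m) ℂ}
    (hhom : g.IsHomogeneous (m * δ))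
    (hinv : ∀ P : Matrix (Fin m) (Fin m) ℂ, P.det = 1 → linSubst (MatIdx m) ℂ (rowOp P) g = g) :
    ∃ c : ℂ, g = c • detFormLex ℂ m ^ δ := by
  classical
  -- Step 1: `g = g(diag(1,…,1,det))` as polynomials, via `g · det = g(diag(…,det)) · det` pointwise.
  have hpt : ∀ A : Matrix (Fin m) (Fin m) ℂ, A.det ≠ 0 →
      eval (vecOf A) g = eval (vecOf (cornerDiag A.det)) g := by
    intro A hA
    obtain ⟨P, hP, hAP⟩ := exists_eq_mul_cornerDiag hA
    have h := congrArg (eval (vecOf (cornerDiag A.det))) (hinv P hP)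
    rw [eval_vecOf_linSubst_rowOp, ← hAP] at h
    exact h
  have hmul : g * detFormLex ℂ m = aeval (cornerSubst m) g * detFormLex ℂ m := by
    apply MvPolynomial.funext
    intro x
    rw [map_mul, map_mul, eval_detFormLex]
    by_cases hx : (matOf x).det = 0
    · rw [hx, mul_zero, mul_zero]
    · congr 1
      rw [Literature.RingTheory.MvPolynomial.eval_aeval_eq_eval, eval_cornerSubst]
      have h := hpt (matOf x) hx
      rwa [vecOf_matOf] at h
  have hg : g = Polynomial.aeval (detFormLex ℂ m) (aeval (cornerSubstU m) g) := by
    rw [← aeval_cornerSubst_eq]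
    exact mul_right_cancel₀ detFormLex_ne_zero hmul
  -- Step 2: expand `h(det)` in powers of `det` and take the degree-`mδ` component.
  set h : Polynomial ℂ := aeval (cornerSubstU m) g with hh
  rw [Polynomial.aeval_eq_sum_range] at hg
  have hcomp := congrArg (homogeneousComponent (m * δ)) hg
  rw [homogeneousComponent_of_mem hhom, if_pos rfl, map_sum] at hcomp
  have hterm : ∀ k ∈ Finset.range (h.natDegree + 1),
      homogeneousComponent (m * δ) (h.coeff k • detFormLex ℂ m ^ k) =
        if δ = k then h.coeff δ • detFormLex ℂ m ^ δ else 0 := by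
    intro k _
    rw [map_smul, homogeneousComponent_of_mem
      ((mem_homogeneousSubmodule _ _).mpr ((detFormLex_isHomogeneous ℂ m).pow k))]
    by_cases hk : δ = k
    · subst hk; rw [if_pos rfl, if_pos rfl]
    · have : m * δ ≠ m * k := fun h' => hk (Nat.eq_of_mul_eq_mul_left (NeZero.pos m) h')
      rw [if_neg this, if_neg hk, smul_zero]
  rw [Finset.sum_congr rfl hterm, Finset.sum_ite_eq] at hcomp
  by_cases hδ : δ ∈ Finset.range (h.natDegree + 1)
  · rw [if_pos hδ] at hcomp
    exact ⟨h.coeff δ, hcomp⟩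
  · rw [if_neg hδ] at hcomp
    exact ⟨0, by rw [hcomp, zero_smul]⟩

end Core

/-! ### From the truncation to the core lemma -/

section Transfer

variable [NeZero m]

/-- The last-row embedding of variables `l ↦ (iLast, l)`. -/
def lastRow (m : ℕ) [NeZero m] (l : MatIdx m) : MatIdx m × MatIdx m := (iLast m, l)

/-- `lastRow` is injective. -/
theorem lastRow_injective : Function.Injective (lastRow m) :=
  fun _ _ h => (Prod.ext_iff.mp h).2

/-- **Lemma R, packaged.** A semi-invariant of weight `(0,…,0,-n)` is a polynomial in the last-row
variables: `G = g(A_last)`. -/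
theorem exists_rename_lastRow_eq {n : ℕ} {G : MvPolynomial (MatIdx m × MatIdx m) ℂ}
    (hB : G ∈ borelSemiInvariants m (lastWeight m n)) :
    ∃ g : MvPolynomial (MatIdx m) ℂ, rename (lastRow m) g = G := by
  classical
  apply exists_rename_eq_of_vars_subset_range G (lastRow m) lastRow_injective
  intro p hp
  rw [Finset.mem_coe, mem_vars_iff_mem_support] at hp
  obtain ⟨e, he, hpe⟩ := hp
  have h1 : p.1 = iLast m := by
    by_contra hne
    exact (Finsupp.mem_support_iff.mp hpe) (apply_eq_zero_of_mem_borelSemiInvariants_lastWeight hB he hne)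
  exact ⟨p.2, Prod.ext h1.symm rfl⟩

/-- The Stab substitution restricted to the last row is `linSubst`. -/
theorem aeval_stabFun_comp_rename_lastRow (M : Matrix (MatIdx m) (MatIdx m) ℂ) :
    (aeval (R := ℂ) fun p : MatIdx m × MatIdx m =>
        ∑ l : MatIdx m, M l p.2 • (X (p.1, l) : MvPolynomial (MatIdx m × MatIdx m) ℂ)).comp
      (rename (lastRow m)) =
    (rename (lastRow m)).comp (linSubst (MatIdx m) ℂ M) := by
  apply MvPolynomial.algHom_ext
  intro i
  simp only [AlgHom.comp_apply, rename_X, aeval_X, linSubst_X, map_sum, map_smul]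
  rfl

/-- **The Stab clause descends to the last row**: if `g(A_last)` is right-`Stab(det_m)`-invariant
then `g ∘ M = g` for every `M ∈ Stab(det_m)`. -/
theorem linSubst_eq_of_rename_mem_stabInvariants {g : MvPolynomial (MatIdx m) ℂ}
    (hS : rename (lastRow m) g ∈ stabInvariants m) {M : Matrix (MatIdx m) (MatIdx m) ℂ}
    (hM : linSubst (MatIdx m) ℂ M (detFormLex ℂ m) = detFormLex ℂ m) :
    linSubst (MatIdx m) ℂ M g = g := by
  have h := (mem_stabInvariants_iff.mp hS) M hM
  have h2 := AlgHom.congr_fun (aeval_stabFun_comp_rename_lastRow (m := m) M) g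
  simp only [AlgHom.comp_apply] at h2
  rw [h2] at h
  exact rename_injective _ lastRow_injective h

/-- **`T ⊆ ℂ · det_m(A_last)^δ` on the one-row weight**, for every locus `L` and threshold `t`. -/
theorem truncation_lastWeight_le_span (L : Set (MatIdx m × MatIdx m → ℂ)) (t δ : ℕ) :
    truncation m L t (m * δ) (lastWeight m (m * δ)) ≤
      ℂ ∙ rename (lastRow m) (detFormLex ℂ m ^ δ) := by
  intro G hG
  rw [mem_truncation_iff] at hG
  obtain ⟨hH, -, hS, hB⟩ := hG
  obtain ⟨g, rfl⟩ := exists_rename_lastRow_eq hB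
  have hhom : g.IsHomogeneous (m * δ) :=
    (IsHomogeneous.rename_isHomogeneous_iff lastRow_injective).mp ((mem_homogeneousSubmodule _ _).mp hH)
  have hinv : ∀ P : Matrix (Fin m) (Fin m) ℂ, P.det = 1 → linSubst (MatIdx m) ℂ (rowOp P) g = g :=
    fun P hP => linSubst_eq_of_rename_mem_stabInvariants hS (linSubst_rowOp_detFormLex_of_det_eq_one hP)
  obtain ⟨c, hc⟩ := exists_eq_smul_detFormLex_pow hhom hinv
  rw [Submodule.mem_span_singleton]
  exact ⟨c, by rw [hc, map_smul]⟩

/-- `det_m(A_last)^δ ≠ 0`. -/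
theorem rename_lastRow_detFormLex_pow_ne_zero (δ : ℕ) :
    rename (lastRow m) (detFormLex ℂ m ^ δ) ≠ 0 := by
  rw [Ne, ← map_zero (rename (lastRow m)), (rename_injective _ lastRow_injective).eq_iff]
  exact pow_ne_zero δ detFormLex_ne_zero

/-- **`dim T ≤ 1` on the one-row weight**, for every `m ≥ 1`, locus, threshold and `δ`. -/
theorem finrank_truncation_lastWeight_le_one (L : Set (MatIdx m × MatIdx m → ℂ)) (t δ : ℕ) :
    Module.finrank ℂ (truncation m L t (m * δ) (lastWeight m (m * δ))) ≤ 1 := by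
  have hle := truncation_lastWeight_le_span (m := m) L t δ
  haveI : FiniteDimensional ℂ (ℂ ∙ rename (lastRow m) (detFormLex ℂ m ^ δ)) :=
    FiniteDimensional.span_singleton ℂ _
  haveI : FiniteDimensional ℂ (truncation m L t (m * δ) (lastWeight m (m * δ))) :=
    Submodule.finiteDimensional_of_le hle
  exact (Submodule.finrank_mono hle).trans
    (finrank_span_singleton (rename_lastRow_detFormLex_pow_ne_zero (m := m) δ)).le

/-- **THE REVERSE INEQUALITY on one-row shapes (tightness at every `m`).** For every `m ≥ 1`,
every `U`, `r`, `δ`: `dim T_U((mδ)) ≤ 1 ≤ K_m((mδ)*)`, with the crux's own locus, threshold and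
weight. No rank hypothesis on `U` is needed for this direction. -/
theorem finrank_truncation_indiscrete_le_orbitMultiplicity (U : Submodule ℂ (MatIdx m → ℂ)) (r δ : ℕ) :
    Module.finrank ℂ (truncation m (rowLocus m U) (δ * (m - r)) (m * δ)
        (Weight.dualOfPartition (m * m) (Nat.Partition.indiscrete (m * δ))).toMatIdx) ≤
      orbitMultiplicity ℂ (detFormLex ℂ m) m
        (Weight.dualOfPartition (m * m) (Nat.Partition.indiscrete (m * δ))).toMatIdx := by
  rw [toMatIdx_dualOfPartition_indiscrete]
  exact (finrank_truncation_lastWeight_le_one _ _ δ).trans (one_le_orbitMultiplicity_det_lastWeight m δ)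

/-- **Tightness, stated against the crux**: `ValuativeBound` forces `K_m((mδ)*) = dim T_U((mδ)) = 1`
for every `m ≥ 1`, every rank-bounded `U`, every `δ`. -/
theorem valuativeBound_tight_oneRow
    (hVB : Summit.ValiantsHypothesis.ValiantsHypothesis.Theses.ValuativeGCT.ValuativeBound)
    (U : Submodule ℂ (MatIdx m → ℂ)) (r : ℕ)
    (hU : ∀ u ∈ U, (Matrix.of fun a b : Fin m => u (toLex (a, b))).rank ≤ r) (δ : ℕ) :
    orbitMultiplicity ℂ (detFormLex ℂ m) m
        (Weight.dualOfPartition (m * m) (Nat.Partition.indiscrete (m * δ))).toMatIdx =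
      Module.finrank ℂ (truncation m (rowLocus m U) (δ * (m - r)) (m * δ)
        (Weight.dualOfPartition (m * m) (Nat.Partition.indiscrete (m * δ))).toMatIdx) ∧
    Module.finrank ℂ (truncation m (rowLocus m U) (δ * (m - r)) (m * δ)
        (Weight.dualOfPartition (m * m) (Nat.Partition.indiscrete (m * δ))).toMatIdx) = 1 := by
  have hle := (valuativeBound_iff.mp hVB) m U r hU δ (Nat.Partition.indiscrete (m * δ))
    (card_parts_indiscrete_le m _)
  have hge := finrank_truncation_indiscrete_le_orbitMultiplicity (m := m) U r δ
  have h1 := one_le_orbitMultiplicity_det_indiscrete m δ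
  have h2 : Module.finrank ℂ (truncation m (rowLocus m U) (δ * (m - r)) (m * δ)
      (Weight.dualOfPartition (m * m) (Nat.Partition.indiscrete (m * δ))).toMatIdx) ≤ 1 := by
    rw [toMatIdx_dualOfPartition_indiscrete]
    exact finrank_truncation_lastWeight_le_one _ _ δ
  omega

/-- **The STRICT variant fails at every `m ≥ 1`** (not only at `m = 1`, `valuativeBound_false_strict`):
on the one-row shape `dim T ≤ 1 ≤ K`. -/
theorem not_orbitMultiplicity_lt_finrank_truncation_indiscrete (U : Submodule ℂ (MatIdx m → ℂ)) (r δ : ℕ) :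
    ¬ orbitMultiplicity ℂ (detFormLex ℂ m) m
        (Weight.dualOfPartition (m * m) (Nat.Partition.indiscrete (m * δ))).toMatIdx <
      Module.finrank ℂ (truncation m (rowLocus m U) (δ * (m - r)) (m * δ)
        (Weight.dualOfPartition (m * m) (Nat.Partition.indiscrete (m * δ))).toMatIdx) :=
  not_lt.mpr (finrank_truncation_indiscrete_le_orbitMultiplicity U r δ)

end Transfer

end TightOneRow

/-! ## §6  The valuative cut is BLIND on compression spaces (cycle 3): Stab-torus balance ⇒
`Hom_(mδ) ⊓ Stab ≤ I(L_U)^(δ(m-r))` for `U = blockSpace R C`, `r = 2m - |R| - |C|` -/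

section StabTorus

variable {m : ℕ}

/-! ### The `Stab` torus -/

/-- The torus substitution `x_{ab} ↦ s_a t_b x_{ab}` as a (diagonal) matrix on `MatIdx m`. -/
def torusDiag (s t : Fin m → ℂ) : Matrix (MatIdx m) (MatIdx m) ℂ :=
  Matrix.diagonal fun l => s (ofLex l).1 * t (ofLex l).2

/-- `torusDiag` rescales each variable. -/
theorem linSubst_torusDiag_X (s t : Fin m → ℂ) (l : MatIdx m) :
    linSubst (MatIdx m) ℂ (torusDiag s t) (X l) = (s (ofLex l).1 * t (ofLex l).2) • (X l : MvPolynomial (MatIdx m) ℂ) := by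
  classical
  rw [torusDiag, linSubst_X, Finset.sum_eq_single l]
  · rw [Matrix.diagonal_apply_eq]
  · intro j _ hj
    rw [Matrix.diagonal_apply_ne _ hj, zero_smul]
  · intro h; exact absurd (Finset.mem_univ _) h

/-- **`det_m(diag(s)·x·diag(t)) = ∏ s · ∏ t · det_m(x)`** as a substitution identity. -/
theorem linSubst_torusDiag_detFormLex (s t : Fin m → ℂ) :
    linSubst (MatIdx m) ℂ (torusDiag s t) (detFormLex ℂ m) =
      C ((∏ a, s a) * ∏ b, t b) * detFormLex ℂ m := by
  classical
  rw [detFormLex, detPoly, AlgHom.map_det, AlgHom.map_det]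
  have hmat : ((linSubst (MatIdx m) ℂ (torusDiag s t)).mapMatrix
      ((rename toLex : MvPolynomial (Fin m × Fin m) ℂ →ₐ[ℂ] _).mapMatrix
        (Matrix.mvPolynomialX (Fin m) (Fin m) ℂ))) =
      Matrix.diagonal (fun a => C (s a)) *
        (rename toLex : MvPolynomial (Fin m × Fin m) ℂ →ₐ[ℂ] _).mapMatrix
          (Matrix.mvPolynomialX (Fin m) (Fin m) ℂ) * Matrix.diagonal (fun b => C (t b)) := by
    ext a b
    simp only [AlgHom.mapMatrix_apply, Matrix.map_apply, Matrix.mvPolynomialX_apply, rename_X,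
      linSubst_torusDiag_X, ofLex_toLex, Matrix.mul_diagonal, Matrix.diagonal_mul, smul_eq_C_mul, map_mul]
    ring
  rw [hmat, Matrix.det_mul, Matrix.det_mul, Matrix.det_diagonal, Matrix.det_diagonal, ← map_prod, ← map_prod,
    map_mul]
  ring

/-- Torus elements with `∏ s · ∏ t = 1` stabilise `det_m`. -/
theorem linSubst_torusDiag_detFormLex_of_eq_one {s t : Fin m → ℂ} (h : (∏ a, s a) * ∏ b, t b = 1) :
    linSubst (MatIdx m) ℂ (torusDiag s t) (detFormLex ℂ m) = detFormLex ℂ m := by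
  rw [linSubst_torusDiag_detFormLex, h, map_one, one_mul]

/-- The Stab substitution at a torus element is the diagonal rescaling
`X (i, l) ↦ s_{a(l)} t_{b(l)} X (i, l)`. -/
theorem stabFun_torusDiag (s t : Fin m → ℂ) :
    (fun p : MatIdx m × MatIdx m => ∑ l : MatIdx m, torusDiag s t l p.2 •
        (X (p.1, l) : MvPolynomial (MatIdx m × MatIdx m) ℂ)) =
      fun p => (s (ofLex p.2).1 * t (ofLex p.2).2) • X p := by
  classical
  funext p
  rw [Finset.sum_eq_single p.2]
  · rw [torusDiag, Matrix.diagonal_apply_eq]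
  · intro l _ hl
    rw [torusDiag, Matrix.diagonal_apply_ne _ hl, zero_smul]
  · intro h; exact absurd (Finset.mem_univ _) h

/-! ### Balance: every monomial of a Stab-invariant form meets each matrix row and column `δ` times -/

/-- Test weights: `2` on `a`, `2⁻¹` on `a'`, `1` elsewhere. -/
noncomputable def twoAt (a a' : Fin m) (x : Fin m) : ℂ :=
  if x = a then 2 else if x = a' then 2⁻¹ else 1

/-- `∏ twoAt a a' = 1` for `a ≠ a'`. -/
theorem prod_twoAt {a a' : Fin m} (h : a ≠ a') : ∏ x, twoAt a a' x = 1 := by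
  classical
  have hsub : ({a, a'} : Finset (Fin m)) ⊆ Finset.univ := Finset.subset_univ _
  rw [← Finset.prod_sdiff hsub, Finset.prod_pair h]
  have h1 : ∏ x ∈ Finset.univ \ {a, a'}, twoAt a a' x = 1 := by
    refine Finset.prod_eq_one fun x hx => ?_
    simp only [Finset.mem_sdiff, Finset.mem_insert, Finset.mem_singleton, not_or] at hx
    simp [twoAt, hx.2.1, hx.2.2]
  rw [h1, one_mul]
  simp [twoAt, h.symm]

/-- Core balance lemma: if `G` is fixed by the rescaling `X p ↦ twoAt a a' (κ p) • X p` for all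
`a ≠ a'`, then on every monomial of `G` the `κ`-fibre sums of exponents are all equal. -/
theorem fibreSum_eq_of_invariant (κ : MatIdx m × MatIdx m → Fin m) {G : MvPolynomial (MatIdx m × MatIdx m) ℂ}
    (hinv : ∀ a a' : Fin m, a ≠ a' →
      MvPolynomial.aeval (fun p : MatIdx m × MatIdx m => twoAt a a' (κ p) • (X p : MvPolynomial _ ℂ)) G = G)
    {e : MatIdx m × MatIdx m →₀ ℕ} (he : e ∈ G.support) (a a' : Fin m) :
    (∑ p ∈ Finset.univ.filter (fun p => κ p = a), e p) =
      ∑ p ∈ Finset.univ.filter (fun p => κ p = a'), e p := by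
  classical
  by_cases haa : a = a'
  · rw [haa]
  have h := hinv a a' haa
  rw [aeval_smul_X_eq_linSubst_diagonal] at h
  have hc := congrArg (coeff e) h
  rw [coeff_linSubst_diagonal'] at hc
  have hce : coeff e G ≠ 0 := mem_support_iff.mp he
  have hprod : (∏ p : MatIdx m × MatIdx m, twoAt a a' (κ p) ^ e p) = 1 :=
    mul_right_cancel₀ hce (hc.trans (one_mul _).symm)
  -- split the product along the fibres of `a`, `a'` and the rest
  set Sa := ∑ p ∈ Finset.univ.filter (fun p => κ p = a), e p with hSa
  set Sa' := ∑ p ∈ Finset.univ.filter (fun p => κ p = a'), e p with hSa'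
  have hA : ∏ p ∈ Finset.univ.filter (fun p => κ p = a), twoAt a a' (κ p) ^ e p = 2 ^ Sa := by
    rw [hSa, ← Finset.prod_pow_eq_pow_sum]
    refine Finset.prod_congr rfl fun p hp => ?_
    rw [(Finset.mem_filter.mp hp).2]; simp [twoAt]
  have hA' : ∏ p ∈ Finset.univ.filter (fun p => κ p = a'), twoAt a a' (κ p) ^ e p = 2⁻¹ ^ Sa' := by
    rw [hSa', ← Finset.prod_pow_eq_pow_sum]
    refine Finset.prod_congr rfl fun p hp => ?_
    rw [(Finset.mem_filter.mp hp).2]; simp [twoAt, Ne.symm haa]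
  have hrest : ∏ p ∈ (Finset.univ.filter fun p => ¬ κ p = a).filter (fun p => ¬ κ p = a'),
      twoAt a a' (κ p) ^ e p = 1 := by
    refine Finset.prod_eq_one fun p hp => ?_
    simp only [Finset.mem_filter, Finset.mem_univ, true_and] at hp
    simp [twoAt, hp.1, hp.2]
  have hsplit : (∏ p : MatIdx m × MatIdx m, twoAt a a' (κ p) ^ e p) = 2 ^ Sa * 2⁻¹ ^ Sa' := by
    rw [← Finset.prod_filter_mul_prod_filter_not Finset.univ (fun p => κ p = a), hA,
      ← Finset.prod_filter_mul_prod_filter_not (Finset.univ.filter fun p => ¬ κ p = a) (fun p => κ p = a'),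
      hrest, mul_one]
    congr 1
    rw [← hA']
    refine Finset.prod_congr ?_ fun _ _ => rfl
    ext p
    simp only [Finset.mem_filter, Finset.mem_univ, true_and]
    constructor
    · rintro ⟨_, h2⟩; exact h2
    · intro h2; exact ⟨fun h1 => haa (h1.symm.trans h2), h2⟩
  rw [hsplit] at hprod
  have h2 : (2 : ℂ) ^ Sa = 2 ^ Sa' := by
    have h3 : (2 : ℂ) ^ Sa * 2⁻¹ ^ Sa' * 2 ^ Sa' = 1 * 2 ^ Sa' := by rw [hprod]
    rwa [mul_assoc, ← mul_pow, inv_mul_cancel₀ (two_ne_zero' ℂ), one_pow, mul_one, one_mul] at h3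
  by_contra hne
  exact two_pow_ne_two_pow hne h2

/-- Slots of the monomial `e` in matrix row `a` (second coordinate of the variable `X (i, (a, b))`). -/
def rowSlots (a : Fin m) (e : MatIdx m × MatIdx m →₀ ℕ) : ℕ :=
  ∑ p ∈ Finset.univ.filter (fun p : MatIdx m × MatIdx m => (ofLex p.2).1 = a), e p

/-- Slots of the monomial `e` in matrix column `b`. -/
def colSlots (b : Fin m) (e : MatIdx m × MatIdx m →₀ ℕ) : ℕ :=
  ∑ p ∈ Finset.univ.filter (fun p : MatIdx m × MatIdx m => (ofLex p.2).2 = b), e p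

/-- **Row balance** for Stab-invariants. -/
theorem rowSlots_eq_rowSlots {G : MvPolynomial (MatIdx m × MatIdx m) ℂ} (hS : G ∈ stabInvariants m)
    {e : MatIdx m × MatIdx m →₀ ℕ} (he : e ∈ G.support) (a a' : Fin m) : rowSlots a e = rowSlots a' e := by
  refine fibreSum_eq_of_invariant (fun p => (ofLex p.2).1) (fun a a' haa => ?_) he a a'
  have h := (mem_stabInvariants_iff.mp hS) (torusDiag (twoAt a a') 1)
    (linSubst_torusDiag_detFormLex_of_eq_one (by rw [prod_twoAt haa]; simp))
  rw [stabFun_torusDiag] at h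
  simpa only [Pi.one_apply, mul_one] using h

/-- **Column balance** for Stab-invariants. -/
theorem colSlots_eq_colSlots {G : MvPolynomial (MatIdx m × MatIdx m) ℂ} (hS : G ∈ stabInvariants m)
    {e : MatIdx m × MatIdx m →₀ ℕ} (he : e ∈ G.support) (b b' : Fin m) : colSlots b e = colSlots b' e := by
  refine fibreSum_eq_of_invariant (fun p => (ofLex p.2).2) (fun b b' hbb => ?_) he b b'
  have h := (mem_stabInvariants_iff.mp hS) (torusDiag 1 (twoAt b b'))
    (linSubst_torusDiag_detFormLex_of_eq_one (by rw [prod_twoAt hbb]; simp))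
  rw [stabFun_torusDiag] at h
  simpa only [Pi.one_apply, one_mul] using h

/-- The total number of slots is the degree. -/
theorem sum_univ_eq_of_mem_homogeneousSubmodule {n : ℕ} {G : MvPolynomial (MatIdx m × MatIdx m) ℂ}
    (hH : G ∈ MvPolynomial.homogeneousSubmodule (MatIdx m × MatIdx m) ℂ n)
    {e : MatIdx m × MatIdx m →₀ ℕ} (he : e ∈ G.support) : ∑ p, e p = n := by
  have hdeg : e.degree = n := by
    rw [Finsupp.degree_eq_weight_one]
    exact (mem_homogeneousSubmodule n G).mp hH (mem_support_iff.mp he)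
  rw [← hdeg, Finsupp.degree_eq_sum]

/-- **Exactly `δ` slots in every matrix row** (degree `mδ` Stab-invariants). -/
theorem rowSlots_eq {δ : ℕ} {G : MvPolynomial (MatIdx m × MatIdx m) ℂ}
    (hH : G ∈ MvPolynomial.homogeneousSubmodule (MatIdx m × MatIdx m) ℂ (m * δ))
    (hS : G ∈ stabInvariants m) {e : MatIdx m × MatIdx m →₀ ℕ} (he : e ∈ G.support) (a : Fin m) :
    rowSlots a e = δ := by
  have htot : ∑ a' : Fin m, rowSlots a' e = m * δ := by
    rw [← sum_univ_eq_of_mem_homogeneousSubmodule hH he]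
    exact Finset.sum_fiberwise Finset.univ (fun p : MatIdx m × MatIdx m => (ofLex p.2).1) e
  rw [Finset.sum_congr rfl (fun a' _ => rowSlots_eq_rowSlots hS he a' a), Finset.sum_const,
    Finset.card_univ, Fintype.card_fin, smul_eq_mul] at htot
  exact Nat.eq_of_mul_eq_mul_left (Fin.pos a) htot

/-- **Exactly `δ` slots in every matrix column.** -/
theorem colSlots_eq {δ : ℕ} {G : MvPolynomial (MatIdx m × MatIdx m) ℂ}
    (hH : G ∈ MvPolynomial.homogeneousSubmodule (MatIdx m × MatIdx m) ℂ (m * δ))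
    (hS : G ∈ stabInvariants m) {e : MatIdx m × MatIdx m →₀ ℕ} (he : e ∈ G.support) (b : Fin m) :
    colSlots b e = δ := by
  have htot : ∑ b' : Fin m, colSlots b' e = m * δ := by
    rw [← sum_univ_eq_of_mem_homogeneousSubmodule hH he]
    exact Finset.sum_fiberwise Finset.univ (fun p : MatIdx m × MatIdx m => (ofLex p.2).2) e
  rw [Finset.sum_congr rfl (fun b' _ => colSlots_eq_colSlots hS he b' b), Finset.sum_const,
    Finset.card_univ, Fintype.card_fin, smul_eq_mul] at htot
  exact Nat.eq_of_mul_eq_mul_left (Fin.pos b) htot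

end StabTorus

section CompressionBlind

variable {m : ℕ}

/-! ### Compression spaces and the block count -/

/-- The coordinate compression space: matrices vanishing on the block `R × C`. Every member has
rank `≤ (m - |R|) + (m - |C|)`. -/
def blockSpace (R C : Finset (Fin m)) : Submodule ℂ (MatIdx m → ℂ) where
  carrier := {u | ∀ a ∈ R, ∀ b ∈ C, u (toLex (a, b)) = 0}
  add_mem' := by
    intro u v hu hv a ha b hb
    simp [hu a ha b hb, hv a ha b hb]
  zero_mem' := by
    intro a _ b _
    rfl
  smul_mem' := by
    intro c u hu a ha b hb
    simp [hu a ha b hb]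

/-- Membership in `blockSpace`. -/
theorem mem_blockSpace_iff {R C : Finset (Fin m)} {u : MatIdx m → ℂ} :
    u ∈ blockSpace R C ↔ ∀ a ∈ R, ∀ b ∈ C, u (toLex (a, b)) = 0 := Iff.rfl

/-- Slots of `e` inside the block `R × C`. -/
def blockSlots (R C : Finset (Fin m)) (e : MatIdx m × MatIdx m →₀ ℕ) : ℕ :=
  ∑ p ∈ Finset.univ.filter (fun p : MatIdx m × MatIdx m => (ofLex p.2).1 ∈ R ∧ (ofLex p.2).2 ∈ C), e p

/-- Arithmetic of the count. -/
theorem threshold_le_aux {δ Rc Cc m B rest : ℕ} (h1 : Rc * δ = B + rest) (h2 : rest ≤ (m - Cc) * δ)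
    (hC : Cc ≤ m) : δ * (Rc + Cc - m) ≤ B := by
  obtain ⟨j, rfl⟩ := Nat.exists_eq_add_of_le hC
  rw [Nat.add_sub_cancel_left] at h2
  by_cases h : Cc + j ≤ Rc + Cc
  · obtain ⟨k, hk⟩ := Nat.exists_eq_add_of_le h
    rw [hk, Nat.add_sub_cancel_left]
    have hR : Rc = j + k := by omega
    subst hR
    rw [add_mul] at h1
    rw [mul_comm]
    omega
  · rw [Nat.sub_eq_zero_of_le (by omega : Rc + Cc ≤ Cc + j), mul_zero]
    exact Nat.zero_le _

/-- **At least `δ(|R| + |C| - m)` slots of a balanced monomial lie in the block.** -/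
theorem le_blockSlots {δ : ℕ} (R C : Finset (Fin m)) {e : MatIdx m × MatIdx m →₀ ℕ}
    (hrow : ∀ a, rowSlots a e = δ) (hcol : ∀ b, colSlots b e = δ) :
    δ * (R.card + C.card - m) ≤ blockSlots R C e := by
  classical
  -- slots with row in R
  set SR := Finset.univ.filter (fun p : MatIdx m × MatIdx m => (ofLex p.2).1 ∈ R) with hSR
  have h1 : ∑ p ∈ SR, e p = R.card * δ := by
    rw [← Finset.sum_fiberwise_of_maps_to (s := SR) (t := R) (g := fun p => (ofLex p.2).1)
      (fun p hp => (Finset.mem_filter.mp hp).2)]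
    rw [Finset.sum_congr rfl (fun a ha => ?_), Finset.sum_const, smul_eq_mul]
    rw [← hrow a, rowSlots]
    refine Finset.sum_congr ?_ fun _ _ => rfl
    ext p
    simp only [hSR, Finset.mem_filter, Finset.mem_univ, true_and]
    exact ⟨fun h => h.2, fun h => ⟨h ▸ ha, h⟩⟩
  -- split by column in C
  have h2 : ∑ p ∈ SR, e p = blockSlots R C e + ∑ p ∈ SR.filter (fun p => ¬ (ofLex p.2).2 ∈ C), e p := by
    rw [← Finset.sum_filter_add_sum_filter_not SR (fun p => (ofLex p.2).2 ∈ C), blockSlots]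
    congr 1
    refine Finset.sum_congr ?_ fun _ _ => rfl
    ext p
    simp [hSR, Finset.mem_filter]
  -- the rest is bounded by the slots in columns outside C
  have h3 : ∑ p ∈ SR.filter (fun p => ¬ (ofLex p.2).2 ∈ C), e p ≤ (m - C.card) * δ := by
    have hsub : SR.filter (fun p => ¬ (ofLex p.2).2 ∈ C) ⊆
        Finset.univ.filter (fun p : MatIdx m × MatIdx m => (ofLex p.2).2 ∈ Cᶜ) := by
      intro p hp
      simp only [Finset.mem_filter, Finset.mem_univ, true_and, Finset.mem_compl] at hp ⊢
      exact hp.2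
    refine (Finset.sum_le_sum_of_subset hsub).trans (le_of_eq ?_)
    rw [← Finset.sum_fiberwise_of_maps_to (s := Finset.univ.filter fun p : MatIdx m × MatIdx m => (ofLex p.2).2 ∈ Cᶜ)
      (t := Cᶜ) (g := fun p => (ofLex p.2).2) (fun p hp => (Finset.mem_filter.mp hp).2)]
    rw [Finset.sum_congr rfl (fun b hb => ?_), Finset.sum_const, Finset.card_compl, Fintype.card_fin,
      smul_eq_mul]
    rw [← hcol b, colSlots]
    refine Finset.sum_congr ?_ fun _ _ => rfl
    ext p
    simp only [Finset.mem_filter, Finset.mem_univ, true_and]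
    exact ⟨fun h => h.2, fun h => ⟨h ▸ hb, h⟩⟩
  exact threshold_le_aux (h1.symm.trans h2).symm.symm h3 (by simpa using C.card_le_univ)

/-- Block variables vanish on `L_U`, `U = blockSpace R C`. -/
theorem X_mem_vanishingIdeal_blockSpace {R C : Finset (Fin m)} {p : MatIdx m × MatIdx m}
    (ha : (ofLex p.2).1 ∈ R) (hb : (ofLex p.2).2 ∈ C) :
    (X p : MvPolynomial (MatIdx m × MatIdx m) ℂ) ∈
      MvPolynomial.vanishingIdeal ℂ (rowLocus m (blockSpace R C)) := by
  rw [MvPolynomial.mem_vanishingIdeal_iff]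
  intro A hA
  rw [aeval_X]
  have h := (mem_blockSpace_iff.mp (hA p.1)) (ofLex p.2).1 ha (ofLex p.2).2 hb
  simpa using h

/-- A monomial with `≥ t` block slots lies in `I(L_U)^t`. -/
theorem monomial_mem_pow_of_le_blockSlots {R C : Finset (Fin m)} {e : MatIdx m × MatIdx m →₀ ℕ} {t : ℕ}
    (ht : t ≤ blockSlots R C e) (c : ℂ) :
    monomial e c ∈ (MvPolynomial.vanishingIdeal ℂ (rowLocus m (blockSpace R C))) ^ t := by
  classical
  have hmon : monomial e c = MvPolynomial.C c * ∏ p, (X p : MvPolynomial (MatIdx m × MatIdx m) ℂ) ^ e p := by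
    rw [monomial_eq, Finsupp.prod_fintype _ _ (fun p => pow_zero _)]
  rw [hmon]
  apply Ideal.mul_mem_left
  rw [← Finset.prod_filter_mul_prod_filter_not Finset.univ
    (fun p : MatIdx m × MatIdx m => (ofLex p.2).1 ∈ R ∧ (ofLex p.2).2 ∈ C)]
  apply Ideal.mul_mem_right
  apply Ideal.pow_le_pow_right ht
  rw [blockSlots, ← Finset.prod_pow_eq_pow_sum]
  exact Ideal.prod_mem_prod fun p hp =>
    Ideal.pow_mem_pow (X_mem_vanishingIdeal_blockSpace (Finset.mem_filter.mp hp).2.1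
      (Finset.mem_filter.mp hp).2.2) _

/-- **Degree + Stab clauses imply the valuative clause at every compression space.** -/
theorem mem_vanishingIdeal_pow_blockSpace (R C : Finset (Fin m)) {δ : ℕ}
    {G : MvPolynomial (MatIdx m × MatIdx m) ℂ}
    (hH : G ∈ MvPolynomial.homogeneousSubmodule (MatIdx m × MatIdx m) ℂ (m * δ))
    (hS : G ∈ stabInvariants m) :
    G ∈ (MvPolynomial.vanishingIdeal ℂ (rowLocus m (blockSpace R C))) ^ (δ * (R.card + C.card - m)) := by
  rw [G.as_sum]
  refine Ideal.sum_mem _ fun e he => monomial_mem_pow_of_le_blockSlots ?_ _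
  exact le_blockSlots R C (rowSlots_eq hH hS he) (colSlots_eq hH hS he)

/-! ### The truncation at a compression space is the symmetric truncation -/

variable (m) in
/-- The SYMMETRIC truncation (no valuative clause): `Hom_n ⊓ Stab-invariants ⊓ B_χ-semi-invariants`. -/
noncomputable def symTruncation (n : ℕ) (χ : Weight (MatIdx m)) :
    Submodule ℂ (MvPolynomial (MatIdx m × MatIdx m) ℂ) :=
  MvPolynomial.homogeneousSubmodule (MatIdx m × MatIdx m) ℂ n ⊓ stabInvariants m ⊓ borelSemiInvariants m χ

/-- Threshold `0` is no condition. -/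
theorem truncation_zero_eq_symTruncation (L : Set (MatIdx m × MatIdx m → ℂ)) (n : ℕ) (χ : Weight (MatIdx m)) :
    truncation m L 0 n χ = symTruncation m n χ := by
  ext G
  rw [mem_truncation_iff, symTruncation, Submodule.mem_inf, Submodule.mem_inf, pow_zero, Ideal.one_eq_top]
  simp only [Submodule.mem_top, true_and, and_assoc]

/-- **COMPRESSION BLINDNESS.** At `U = blockSpace R C` with the crux's threshold `δ(m - r)`,
`r = 2m - |R| - |C|` (so `m - r = |R| + |C| - m`), the valuative truncation IS the symmetric one:
the cut carries no information at any compression space, for every `m`, `δ` and weight. -/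
theorem truncation_blockSpace_eq_symTruncation (R C : Finset (Fin m)) (δ : ℕ) (χ : Weight (MatIdx m)) :
    truncation m (rowLocus m (blockSpace R C)) (δ * (R.card + C.card - m)) (m * δ) χ = symTruncation m (m * δ) χ := by
  refine le_antisymm (fun G hG => ?_) (fun G hG => ?_)
  · rw [mem_truncation_iff] at hG
    rw [symTruncation, Submodule.mem_inf, Submodule.mem_inf]
    exact ⟨⟨hG.1, hG.2.2.1⟩, hG.2.2.2⟩
  · rw [symTruncation, Submodule.mem_inf, Submodule.mem_inf] at hG
    rw [mem_truncation_iff]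
    exact ⟨hG.1.1, mem_vanishingIdeal_pow_blockSpace R C hG.1.1 hG.1.2, hG.1.2, hG.2⟩

/-- The same with the threshold written as in the crux, `δ * (m - r)`, `r = 2m - |R| - |C|`. -/
theorem truncation_blockSpace_cruxThreshold (R C : Finset (Fin m)) (δ : ℕ) (χ : Weight (MatIdx m)) :
    truncation m (rowLocus m (blockSpace R C)) (δ * (m - (2 * m - R.card - C.card))) (m * δ) χ =
      symTruncation m (m * δ) χ := by
  have hR : R.card ≤ m := by simpa using R.card_le_univ
  have hC : C.card ≤ m := by simpa using C.card_le_univ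
  have : m - (2 * m - R.card - C.card) = R.card + C.card - m := by omega
  rw [this]
  exact truncation_blockSpace_eq_symTruncation R C δ χ

/-! ### `blockSpace R C` is admissible in the crux with `r = 2m - |R| - |C|` -/

/-- Subadditivity of the rank (via ranges). -/
theorem rank_add_le' (A B : Matrix (Fin m) (Fin m) ℂ) : (A + B).rank ≤ A.rank + B.rank := by
  unfold Matrix.rank
  rw [Matrix.mulVecLin_add]
  have hle : LinearMap.range (A.mulVecLin + B.mulVecLin) ≤
      LinearMap.range A.mulVecLin ⊔ LinearMap.range B.mulVecLin := by
    rintro _ ⟨x, rfl⟩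
    exact Submodule.add_mem_sup ⟨x, rfl⟩ ⟨x, rfl⟩
  exact (Submodule.finrank_mono hle).trans (Submodule.finrank_add_le_finrank_add_finrank _ _)

/-- The rank of a `0/1` diagonal matrix is at most the number of ones. -/
theorem rank_diagonal_indicator_le (S : Finset (Fin m)) :
    (Matrix.diagonal fun a : Fin m => if a ∈ S then (1 : ℂ) else 0).rank ≤ S.card := by
  classical
  rw [Matrix.rank_diagonal, Fintype.card_subtype]
  refine le_of_eq (congrArg Finset.card ?_)
  ext a
  simp only [Finset.mem_filter, Finset.mem_univ, true_and, ne_eq, ite_eq_right_iff, one_ne_zero,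
    imp_false, not_not]

/-- **Rank bound on a compression space**: `u|_{R × C} = 0 ⇒ rank u ≤ 2m - |R| - |C|`. -/
theorem rank_le_of_mem_blockSpace {R C : Finset (Fin m)} {u : MatIdx m → ℂ} (hu : u ∈ blockSpace R C) :
    (Matrix.of fun a b : Fin m => u (toLex (a, b))).rank ≤ 2 * m - R.card - C.card := by
  classical
  set N : Matrix (Fin m) (Fin m) ℂ := Matrix.of fun a b : Fin m => u (toLex (a, b)) with hN
  set D₁ : Matrix (Fin m) (Fin m) ℂ := Matrix.diagonal fun a => if a ∈ Rᶜ then (1 : ℂ) else 0 with hD₁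
  set D₂ : Matrix (Fin m) (Fin m) ℂ := Matrix.diagonal fun b => if b ∈ Cᶜ then (1 : ℂ) else 0 with hD₂
  set E : Matrix (Fin m) (Fin m) ℂ := Matrix.diagonal fun a => if a ∈ R then (1 : ℂ) else 0 with hE
  have hdec : N = D₁ * N + E * N * D₂ := by
    ext a b
    simp only [Matrix.add_apply, hD₁, hD₂, hE, Matrix.diagonal_mul, Matrix.mul_diagonal, Finset.mem_compl]
    by_cases ha : a ∈ R
    · by_cases hb : b ∈ C
      · have h0 : N a b = 0 := by rw [hN, Matrix.of_apply]; exact (mem_blockSpace_iff.mp hu) a ha b hb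
        simp [h0]
      · simp [ha, hb]
    · simp [ha]
  have hR : R.card ≤ m := by simpa using R.card_le_univ
  have hC : C.card ≤ m := by simpa using C.card_le_univ
  calc N.rank = (D₁ * N + E * N * D₂).rank := by rw [← hdec]
    _ ≤ (D₁ * N).rank + (E * N * D₂).rank := rank_add_le' _ _
    _ ≤ D₁.rank + D₂.rank := add_le_add (Matrix.rank_mul_le_left _ _) (Matrix.rank_mul_le_right _ _)
    _ ≤ Rᶜ.card + Cᶜ.card := add_le_add (rank_diagonal_indicator_le _) (rank_diagonal_indicator_le _)
    _ = 2 * m - R.card - C.card := by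
        rw [Finset.card_compl, Finset.card_compl, Fintype.card_fin]; omega

/-- **The crux, instantiated at any compression space, is its own symmetric special case**: with
`U = blockSpace R C` and `r = 2m - |R| - |C|` the rank hypothesis holds and the right-hand side of
`ValuativeBound` is `finrank (symTruncation)` — the valuative clause is invisible there. -/
theorem valuativeBound_at_blockSpace_iff (R C : Finset (Fin m)) (δ : ℕ) (χ : Weight (MatIdx m)) (K : ℕ) :
    ((∀ u ∈ blockSpace R C, (Matrix.of fun a b : Fin m => u (toLex (a, b))).rank ≤ 2 * m - R.card - C.card) →
      K ≤ Module.finrank ℂ (truncation m (rowLocus m (blockSpace R C))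
        (δ * (m - (2 * m - R.card - C.card))) (m * δ) χ)) ↔
    K ≤ Module.finrank ℂ (symTruncation m (m * δ) χ) := by
  rw [truncation_blockSpace_cruxThreshold]
  exact ⟨fun h => h fun u hu => rank_le_of_mem_blockSpace hu, fun h _ => h⟩

end CompressionBlind

/-! ## §7  Orbit invariance and monotonicity of the truncation (cycle 3) -/

section OrbitInvariance

variable {m : ℕ}

/-- The right substitution `G ↦ G ∘ (A ↦ A·M)` of the Stab clause, as an algebra map. -/
noncomputable def stabSubst (M : Matrix (MatIdx m) (MatIdx m) ℂ) :
    MvPolynomial (MatIdx m × MatIdx m) ℂ →ₐ[ℂ] MvPolynomial (MatIdx m × MatIdx m) ℂ :=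
  MvPolynomial.aeval fun p : MatIdx m × MatIdx m =>
    ∑ l : MatIdx m, M l p.2 • (X (p.1, l) : MvPolynomial (MatIdx m × MatIdx m) ℂ)

/-- `stabSubst M G` at the point `A` is `G` at `A·M` (`(A·M)(i, l') = ∑_l A(i, l) M(l, l')`). -/
theorem eval_stabSubst (M : Matrix (MatIdx m) (MatIdx m) ℂ) (A : MatIdx m × MatIdx m → ℂ)
    (G : MvPolynomial (MatIdx m × MatIdx m) ℂ) :
    eval A (stabSubst M G) = eval (fun p => ∑ l : MatIdx m, A (p.1, l) * M l p.2) G := by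
  have hfun : (fun p : MatIdx m × MatIdx m => eval A (∑ l : MatIdx m, M l p.2 •
      (X (p.1, l) : MvPolynomial (MatIdx m × MatIdx m) ℂ))) = fun p => ∑ l : MatIdx m, A (p.1, l) * M l p.2 := by
    funext p
    simp only [map_sum, smul_eval, eval_X]
    exact Finset.sum_congr rfl fun l _ => mul_comm _ _
  rw [stabSubst, Literature.RingTheory.MvPolynomial.eval_aeval_eq_eval, hfun]

/-- Stab-invariants are fixed by `stabSubst M`, `M ∈ Stab(det_m)`. -/
theorem stabSubst_eq_self_of_mem_stabInvariants {G : MvPolynomial (MatIdx m × MatIdx m) ℂ}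
    (hS : G ∈ stabInvariants m) {M : Matrix (MatIdx m) (MatIdx m) ℂ}
    (hM : linSubst (MatIdx m) ℂ M (detFormLex ℂ m) = detFormLex ℂ m) : stabSubst M G = G :=
  (mem_stabInvariants_iff.mp hS) M hM

/-- `A ↦ A·M` maps `L_{U·M⁻¹}` into `L_U`, where `U·M⁻¹ = comap (· ᵥ* M) U`. -/
theorem rowMul_mem_rowLocus {U : Submodule ℂ (MatIdx m → ℂ)} {M : Matrix (MatIdx m) (MatIdx m) ℂ}
    {A : MatIdx m × MatIdx m → ℂ} (hA : A ∈ rowLocus m (U.comap (Matrix.vecMulLinear M))) :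
    (fun p : MatIdx m × MatIdx m => ∑ l : MatIdx m, A (p.1, l) * M l p.2) ∈ rowLocus m U := by
  intro j
  have h := hA j
  rw [Submodule.mem_comap] at h
  exact h

/-- `stabSubst M` maps `I(L_U)` into `I(L_{U·M⁻¹})`. -/
theorem stabSubst_mem_vanishingIdeal {U : Submodule ℂ (MatIdx m → ℂ)} (M : Matrix (MatIdx m) (MatIdx m) ℂ)
    {G : MvPolynomial (MatIdx m × MatIdx m) ℂ} (hG : G ∈ MvPolynomial.vanishingIdeal ℂ (rowLocus m U)) :
    stabSubst M G ∈ MvPolynomial.vanishingIdeal ℂ (rowLocus m (U.comap (Matrix.vecMulLinear M))) := by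
  rw [MvPolynomial.mem_vanishingIdeal_iff] at hG ⊢
  intro A hA
  have h := hG _ (rowMul_mem_rowLocus hA)
  have e1 : MvPolynomial.aeval A (stabSubst M G) = eval A (stabSubst M G) := rfl
  have e2 : MvPolynomial.aeval (fun p : MatIdx m × MatIdx m => ∑ l : MatIdx m, A (p.1, l) * M l p.2) G =
      eval (fun p : MatIdx m × MatIdx m => ∑ l : MatIdx m, A (p.1, l) * M l p.2) G := rfl
  rw [e1, eval_stabSubst, ← e2]
  exact h

/-- … and hence `I(L_U)^t` into `I(L_{U·M⁻¹})^t`. -/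
theorem stabSubst_mem_vanishingIdeal_pow {U : Submodule ℂ (MatIdx m → ℂ)} (M : Matrix (MatIdx m) (MatIdx m) ℂ)
    {t : ℕ} {G : MvPolynomial (MatIdx m × MatIdx m) ℂ}
    (hG : G ∈ (MvPolynomial.vanishingIdeal ℂ (rowLocus m U)) ^ t) :
    stabSubst M G ∈ (MvPolynomial.vanishingIdeal ℂ (rowLocus m (U.comap (Matrix.vecMulLinear M)))) ^ t := by
  have h1 : stabSubst M G ∈ ((MvPolynomial.vanishingIdeal ℂ (rowLocus m U)) ^ t).map (stabSubst M) :=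
    Ideal.mem_map_of_mem _ hG
  rw [Ideal.map_pow] at h1
  refine Ideal.pow_right_mono ?_ t h1
  rw [Ideal.map_le_iff_le_comap]
  intro G' hG'
  exact stabSubst_mem_vanishingIdeal M hG'

/-- **`T_U ≤ T_{U·M⁻¹}` for every `M ∈ Stab(det_m)`** (invertible or not): the truncation sees `U`
only through its `Stab`-saturation. -/
theorem truncation_rowLocus_le_comap (U : Submodule ℂ (MatIdx m → ℂ)) {M : Matrix (MatIdx m) (MatIdx m) ℂ}
    (hM : linSubst (MatIdx m) ℂ M (detFormLex ℂ m) = detFormLex ℂ m) (t n : ℕ) (χ : Weight (MatIdx m)) :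
    truncation m (rowLocus m U) t n χ ≤
      truncation m (rowLocus m (U.comap (Matrix.vecMulLinear M))) t n χ := by
  intro G hG
  rw [mem_truncation_iff] at hG ⊢
  obtain ⟨hH, hV, hS, hB⟩ := hG
  refine ⟨hH, ?_, hS, hB⟩
  have h := stabSubst_mem_vanishingIdeal_pow M hV
  rwa [stabSubst_eq_self_of_mem_stabInvariants hS hM] at h

/-- **`T` is antitone in the locus.** -/
theorem truncation_antitone_locus {L L' : Set (MatIdx m × MatIdx m → ℂ)} (h : L ⊆ L') (t n : ℕ)
    (χ : Weight (MatIdx m)) : truncation m L' t n χ ≤ truncation m L t n χ := by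
  intro G hG
  rw [mem_truncation_iff] at hG ⊢
  obtain ⟨hH, hV, hS, hB⟩ := hG
  exact ⟨hH, Ideal.pow_right_mono (MvPolynomial.vanishingIdeal_anti_mono h) t hV, hS, hB⟩

/-- `U ≤ U' ⇒ L_U ⊆ L_{U'}`. -/
theorem rowLocus_mono {U U' : Submodule ℂ (MatIdx m → ℂ)} (h : U ≤ U') : rowLocus m U ⊆ rowLocus m U' :=
  fun _ hA j => h (hA j)

/-- **`T_U` is antitone in `U`**: bigger singular spaces (of the same rank bound) cut more, so only
MAXIMAL singular spaces of each rank matter. -/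
theorem truncation_rowLocus_antitone {U U' : Submodule ℂ (MatIdx m → ℂ)} (h : U ≤ U') (t n : ℕ)
    (χ : Weight (MatIdx m)) : truncation m (rowLocus m U') t n χ ≤ truncation m (rowLocus m U) t n χ :=
  truncation_antitone_locus (rowLocus_mono h) t n χ

/-- **`T` is antitone in the threshold.** -/
theorem truncation_antitone_threshold (L : Set (MatIdx m × MatIdx m → ℂ)) {t t' : ℕ} (h : t ≤ t') (n : ℕ)
    (χ : Weight (MatIdx m)) : truncation m L t' n χ ≤ truncation m L t n χ := by
  intro G hG
  rw [mem_truncation_iff] at hG ⊢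
  obtain ⟨hH, hV, hS, hB⟩ := hG
  exact ⟨hH, Ideal.pow_le_pow_right h hV, hS, hB⟩

end OrbitInvariance

end Summit.ValiantsHypothesis.ValiantsHypothesis.Cruxes.ValuativeBound.Disproof

end
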